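import Mathlib.Analysis.InnerProductSpace.PiL2
import Mathlib.Analysis.Convex.Function
import Mathlib.LinearAlgebra.Determinant
import Mathlib.MeasureTheory.Measure.Hausdorff
import Mathlib.MeasureTheory.Measure.Haar.InnerProductSpace
import Mathlib.Order.LiminfLimsup
import Mathlib.Topology.Instances.ENNReal.Lemmas
import Literature.MathematicalPhysics.StatisticalMechanics.LatticeMaximalFluctuations
import HarnessLib

/-!
# Grain-boundary energy of rigid polycrystals with general cell energies (Kreutz–Ziereis 2026)

Topic `Literature/MathematicalPhysics/StatisticalMechanics` (namespace = path, grouping sub-namespace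
`KreutzZiereis2026` for the paper's vocabulary).  Source: L. Kreutz, T. Ziereis, *Emergence of rigid
polycrystals from atomistic systems with general interactions*, arXiv:2604.19239 (21 Apr 2026), 36 pp.
[KreutzZiereis2026] — an UNREFEREED PREPRINT: every result of the source vendored below is a named
`def … : Prop` tagged `[claim: KreutzZiereis2026, status: under-review]` (D-0012), never asserted.
Page numbers are arXiv v1 pages; the TeX source (`General-Polycrystals-final.tex`) was used to settle
closed/open balls (`\overline{B}` in (E3), (E4), `B_r` open in (L1), (L2)).

Cross-ladder literature-typing layer (D-0088 (4)), cell `crystal3d-full`, seat `littype-FC1-2` (gen 4).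
This paper is the `d`-dimensional successor of Friedrich–Kreutz–Schmidt 2021 (tree:
`StickyDiskGrainBoundaryEnergy.lean`, `d = 2`, sticky disks) and the nearest print to the venture item
`GenericWallFloor` (`stmt-Ventures-19480`): for cell energies that are RIGID in the sense of the axioms
(E1)–(E10) below, a grain boundary between two differently positioned copies of the reference crystal
costs exactly the SUM of the two free-surface energies (Theorem 2.8 (ii)), because competitors of the
boundary-value cell problem can be reduced to subsets of the two boundary lattices at no cost
(Lemma 6.1: "no interpolating boundary layers").  The sticky-sphere cell energy `½(12 − #contacts)`
of the venture is NOT in this class — (E3) fails (a zero-energy atom has twelve contacts, which need not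
form a lattice patch: icosahedral shells, mixed fcc/hcp shells) and (E7) fails (across a coherent twin
both atoms have zero energy and different lattices) — so the claims below are the rigid comparison print,
not a theorem about `GenericWallFloor`'s model; the source itself verifies (E8)–(E10) only in `d = 2` and
prints a `ℤ³` configuration violating (E10) (Appendix A.1, p. 35: "for `d = 3`, i.e. `ℤ³`, (E10) does
not hold").

## Source, as printed (pp. 4–10, 24, Appendix A)

* (2.1) p. 4: "ideal crystals … sets `𝓛 ⊂ ℝ^d` such that there exists `l ∈ ℕ`, `{x₁,…,x_l} ⊂ ℝ^d` and
  `L ∈ GL(d,ℝ)` such that `𝓛 := ⋃_{i=1}^{l} (x_i + Lℤ^d)`.  Note that this implies (L1) (Discreteness)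
  There exists `r > 0` such that for all `x ∈ ℝ^d` it holds `#{B_r(x) ∩ 𝓛} ≤ 1`. (L2) (No large empty
  regions) There exists `R > 0` such that for all `x` it holds `#{B_R(x) ∩ 𝓛} ≥ 1`. (L3) (Periodicity)
  Defining `v_i = Le_i` it holds `𝓛 + v_i = 𝓛`. (L4) (Symmetry) There exists a finite subgroup
  `G ⊂ SO(d)` such that for all `Q ∈ G` it holds `Q𝓛 = 𝓛`."  (2.2): "`V_𝓛(x) := {y : |x−y| ≤ |z−y| ∀z ∈ 𝓛}`";
  (2.3): "`B̄_{r_V}(x) ⊆ V_𝓛(x) ⊆ B̄_{R_V}(x)` … `R_V > 0` is the outerradius of `V_𝓛(x)` (which we assume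
  to be independent of `x ∈ 𝓛`). Further, we define the Voronoi relevant distance as
  `S_V := sup{|x−y| : x,y ∈ 𝓛, H^{d−1}(V_𝓛(x) ∩ V_𝓛(y)) ≠ 0}`."
* p. 5: "`𝔸 := SO(d)/G`", "`𝕋 := ℝ^d/𝓛`", (2.5) "`𝒵 := (𝔸 × 𝕋 × {1}) ∪ {0}`", "there is a unique element
  `[R] ∈ 𝔸, [τ] ∈ 𝕋` such that `R(𝓛+τ) = [R](𝓛+[τ])`"; (2.6) "`𝓛_ε(z) := 𝓛_ε(R,τ,1) := εR(𝓛+τ)`",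
  "`𝓛_ε(0) := ∅`" (vacuum).  "We call a finite subset `X ⊂ ℝ^d` a configuration … `𝒳 := {X ⊂ ℝ^d : X`
  is finite`}`.  We then define a cell energy `E_cell : ℝ^d × 𝒳 → [0,+∞]` satisfying the following
  properties:" — **(E1)–(E10)**, quoted verbatim in the docstrings of `E1` … `E10` below (pp. 5–6).
* (2.7)–(2.8) p. 6: "`E^ε_cell(x,X) := E_cell(x/ε, X/ε)`", "`E_ε(X,A) := ε^{d−1} Σ_{x∈X∩A} E^ε_cell(x,X)`",
  "`E_ε(X) := E_ε(X,ℝ^d)`".  Remark 2.1 p. 7: "From now on, we will work with the stronger assumption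
  `r_crys ≥ 2R_V` … This greatly simplifies the proofs … We will quickly comment on the changes needed to
  recover the results in the general case."
* §2.3 p. 8: "`R_ν` is the orthogonal matrix induced by the linear mapping
  `x ↦ 2(⟨x,ν⟩+x_d)/|ν+e_d|² (ν+e_d) − x` if `ν ∈ S^{d−1}∖{−e_d}`, `−x` otherwise.  In this way
  `R_ν e_d = ν` … `Q^ν := R_ν Q` where `Q := {y : −½ ≤ ⟨y,e_i⟩ < ½ for i = 1,…,d}`"; (2.14):
  "`∂_{λε}Q^ν_ρ(x) := Q^ν_{ρ+λε}(x) ∖ Q^ν_{ρ−λε}(x)`,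
  `∂^±_{λε}Q^ν_ρ(x) = ∂_{λε}Q^ν_ρ(x) ∩ {z : ±⟨z−x,ν⟩ ≥ r_int ε}`,
  `∂^c_{λε}Q^ν_ρ(x) = ∂_{λε}Q^ν_ρ(x) ∖ (∂^+ ∪ ∂^−)`"; "`Q^ν_ρ(x) := x + ρQ^ν`".
* Definition 2.2 p. 8–9: "`X ∈ Adm^{(z⁺,z⁻)}_{ε,λ}(Q^ν_ρ(x))` if (i) `E_ε(X) < +∞`, (ii) `X = 𝓛_ε(z^±)` on
  `∂^±_{λε}Q^ν_ρ(x)`, (iii) `X = ∅` on `∂^c_{λε}Q^ν_ρ(x)`."  ("`X = 𝓛_ε(z)` on `A` if `X ∩ A = 𝓛_ε(z) ∩ A`",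
  Definition 2.1 p. 7.)
* **Proposition 2.5 (Density)** p. 9: "Let `E_cell` satisfy (E1)–(E10). For every `z⁺,z⁻ ∈ 𝒵`,
  `ν ∈ S^{d−1}`, `x₀ ∈ ℝ^d`, `λ > 6r_int`, and `ρ > 0`, there exists
  `φ(z⁺,z⁻,ν) = lim_{ε→0} ρ^{1−d} inf{E_ε(X, Q^ν_ρ(x₀)) : X ∈ Adm^{(z⁺,z⁻)}_{ε,λ}(Q^ν_ρ(x₀))}` (2.15)
  and is independent of `x₀`, `λ`, and `ρ`."
* Definition 2.17 p. 10: "`φ_vac(z,ν) = φ(z,0,ν)`".  **Theorem 2.8 (Properties of `φ`)** p. 10: "Let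
  `E_cell` satisfy (E1)–(E10). Let `φ` be the density in Proposition 2.5 extended to a function defined
  on `𝒵 × 𝒵 × ℝ^d`, which is positively 1-homogeneous in the third variable. … (i) (Solid-vacuum energy)
  It holds `φ(z,0,ν) = φ(0,z,−ν)` for all `z ∈ 𝒵∖{0}` and `ν ∈ S^{d−1}`. (ii) (Solid-solid energy) For
  all `z⁺,z⁻ ∈ 𝒵∖{0}`, `z⁺ ≠ z⁻` and `ν ∈ S^{d−1}` it holds `φ(z⁺,z⁻,ν) = φ_vac(z⁺,ν) + φ_vac(z⁻,−ν)`.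
  (iii) (Convexity) The mapping `ν ↦ φ_vac(z,ν)` is convex for all `z ∈ 𝒵`. (iv) (Boundedness &
  Continuity) There exists `C > 0` such that `φ_vac(z,ν) ≤ C|ν|` for all `ν ∈ ℝ^d`. In particular,
  `ν ↦ φ_vac(z,ν)` is Lipschitz-continuous. (v) (Translational invariance) For all `z = (R,τ,1) ∈ 𝒵`,
  `ν ∈ S^{d−1}` there holds `φ_vac((R,τ,1),ν) = φ_vac((R,0,1),ν)`. (vi) (Rotational invariance) For all
  `z = (R,τ,1)`, `ν ∈ S^{d−1}` and `O ∈ SO(d)` there holds `φ_vac((OR,0,1),Oν) = φ_vac((R,0,1),ν)`."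
* **Lemma 6.1** p. 24: "Let `E_cell` satisfy (E1)–(E10). Let `z⁺,z⁻ ∈ 𝒵`, `ν ∈ S^{d−1}`, `x₀ ∈ ℝ^d`,
  `λ > 8r_int`, and `T > 0`. Let `X ⊂ ℝ^d` be a competitor of
  `inf{E₁(X,Q^ν_T(x₀)) : X ∈ Adm^{z⁺,z⁻}_{1,λ}(Q^ν_T(x₀))}` (6.1) and set `λ̂ = λ − 2r_int`. Then, there
  exist configurations `X^± ⊂ X` with the following properties: (i) (Subset of two Lattices) It holds
  `X^± ⊂ 𝓛(z^±)`. (ii) (Separation) It holds `dist(X⁺,X⁻) > r_int`. (iii) (Admissibility) It holds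
  `X⁺ ∈ Adm^{(z⁺,0)}_{1,λ̂}(Q^ν_T(x₀))` and `X⁻ ∈ Adm^{(0,z⁻)}_{1,λ̂}(Q^ν_T(x₀))` … (iv) (Energy bound) It
  holds `E₁(X⁺,Q^ν_T(x₀)) + E₁(X⁻,Q^ν_T(x₀)) ≤ E₁(X,Q^ν_T(x₀))`."
* Appendix A.1 p. 34–35 (`𝓛 = ℤ^d`, sticky pair term `½(2d − #N₁(x))` plus an angular three-body term):
  "(E1)–(E7) for `d ≤ 4` … for `d = 2` the energy also fulfills (E8)–(E10) … Notice that this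
  argumentation only works in dimension 2. Indeed, for `d = 3`, i.e. `ℤ³` (E10) does not hold."

## Rendering (design choices)

* `ℝ^d` is `EuclideanSpace ℝ (Fin d)`; `SO(d)` acts through `R : ℝ^d ≃ₗᵢ[ℝ] ℝ^d` with `det R = 1`
  (`IsRotation`).  The phase space `𝒵` is rendered by REPRESENTATIVES, exactly as in the tree's
  Friedrich–Kreutz–Schmidt file: `Grain d := Option ((ℝ^d ≃ₗᵢ[ℝ] ℝ^d) × ℝ^d)`, `none` = the vacuum `0`,
  `some (R, τ)` = the positioned crystal `R(𝓛 + τ)` (`grainLattice`); the printed "`z⁺ ≠ z⁻`" (distinct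
  elements of the quotient `𝔸 × 𝕋`) is "`𝓛(z⁺) ≠ 𝓛(z⁻)` as sets" — this is the paper's own
  identification ("there is a unique element `[R], [τ]` such that `R(𝓛+τ) = [R](𝓛+[τ])`", p. 5), and
  the symmetry group `G` of (L4)/(E7) never has to be chosen.
* A configuration is a `Set (EuclideanSpace ℝ (Fin d))` required to be `Finite` wherever the source
  quantifies over `𝒳`; localized energies are `finsum`s in `ℝ≥0∞` (the source's codomain `[0,+∞]`).
* (E7) is rendered by its operative clause "in particular, we can choose `(R_x,τ_x) = (R_y,τ_y)`" in
  set form: any lattice fits at two zero-energy atoms within `r_crys` are the SAME positioned crystal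
  (`R_x(𝓛+τ_x) = R_y(𝓛+τ_y)`), which is what `R_x = QR_y`, `Q ∈ G`, `τ_x = Q⁻¹τ_y + RLz` says for the
  symmetry group `G` and the translation lattice of `𝓛`.  In (E10), "`𝓛(z(x))`" is the positioned crystal
  containing `{x} ∪ 𝒩(x)`, unique by (E8) (this is the reading used in the proof of Lemma 6.1, Step 1
  (2)–(3), p. 24–25, and in Appendix A.1); it is rendered by quantifying over the crystals containing the
  two neighbourhoods.
* `φ(z⁺,z⁻,ν)` is DEFINED (`density`) as the upper limit `ε → 0⁺` of the cell infima on the unit cube at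
  the origin with layer parameter `λ = 7r_int`; Proposition 2.5 is the named fact that for every `x₀`,
  every `λ > 6r_int` and every `ρ > 0` the rescaled infima CONVERGE to this number (existence of the limit
  and independence of `x₀, λ, ρ`), so the arbitrary normalisation is immaterial under the fact.
* Dimension: the source fixes `d ≥ 2`; `e_d` is `eLast d` (the last coordinate vector, junk `0` for
  `d = 0`), and every named fact carries `2 ≤ d`.

## What is here

Definitions with bodies: `intPoint`, `IsIdealCrystal` (2.1), `L1`–`L4`, `outerRadius` (`R_V`),
`voronoiRelevantDist` (`S_V`), `IsRotation`, `positionedCrystals`, `Grain`, `Grain.IsSO`, `grainLattice`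
(2.6), `nbhd` (`𝒩_ε(x)`, (4.1)), `scaledCell` (2.7), `energy` (2.8), `E1` … `E10`, `IsRigidCellEnergy`
(the conjunction (E1)–(E10)), `eLast`, `rNu` (`R_ν`), `unitCube` (`Q`), `cube` (`Q^ν_ρ(x)`), `layer`,
`layerPlus`, `layerMinus`, `layerCompl` (2.14), `IsAdm` (Definition 2.2), `cellInf`, `density` (2.15),
`densityHom`, `phiVac` (2.17).  Proved API: `grainLattice_none`, `grainLattice_one_mem`,
`isIdealCrystal_periodic` ((2.1) ⇒ (L3)), `rNu_of_ne`, `rNu_eLast` (`R_ν e_d = ν`), `energy_empty`,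
`cellInf_le`, `densityHom_of_norm_eq_one`, `phiVac_eq`, and the conditional corollary
`density_eq_upper_add_lower` (Theorem 2.8 (i)+(ii): `φ(z⁺,z⁻,ν) = φ(z⁺,0,ν) + φ(0,z⁻,ν)`).  §8 (Appendix
A.1): `intLattice` (`ℤ^d`, an ideal crystal: `isIdealCrystal_intLattice`), the sticky-plus-angular cell
energy (A.2)–(A.3) `stickyAngularCell` / `badAnglePairs`, and the PROVED counterexample
`not_E10_intLattice_three`: **(E10) fails on `ℤ³`** for this energy (the seven-point configuration
`{0, e₃, 2e₃, e₃ ± e₁, ±Re₁}` with `R = rotQuarter ∈ SO(3)` (`isRotation_rotQuarter`); all distances,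
neighbourhoods, bond angles and the two energies `E₁(X) = 15 < 16 = E₁(X ∖ {e₃})` computed in the kernel).
NAMED FACTS (claims under review, never asserted): `KreutzZiereis2026_density` (Prop. 2.5), `KreutzZiereis2026_solidVacuum` (Thm 2.8 (i)),
`KreutzZiereis2026_solidSolid` (Thm 2.8 (ii)), `KreutzZiereis2026_convex` (iii), `KreutzZiereis2026_bounded`
(iv), `KreutzZiereis2026_translationInvariant` (v), `KreutzZiereis2026_rotationInvariant` (vi),
`KreutzZiereis2026_twoLattices` (Lemma 6.1).

## What is not here

Theorem 2.4 (compactness in `PC(ℝ^d;𝒵) ⊂ SBV`) and Theorem 2.6 (`Γ`-convergence to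
`E(u) = ∫_{J_u} φ(u⁺,u⁻,ν_u) dH^{d−1}`, (2.16)): jump sets and traces of `SBV` fields with values in the
manifold `𝒵` are not available in Mathlib (the same gap recorded for FKS 2021 Theorems 2.1/2.3); Lemma 4.2
(coercivity `H^{d−1}(J_u ∩ A) ≤ C E_ε(X,(A)_{2εr_crys})`), Lemmas 5.1–5.2, 6.2, 7.1–7.4, 8.1 (cell-formula
technology with converging boundary data) and the Appendix A formulas "`φ_vac(ν) = ½‖ν‖₁`" (`ℤ^d`) and the
honeycomb density ("it can be shown"), and the positive claims of Appendix A.1 ("(E1)–(E7) for `d ≤ 4`",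
"(E8)–(E10) for `d = 2` if `C_{V₃} > 8`") — recorded, not typed.  No instances, no notation, no `sorry`.
-/

noncomputable section

open scoped InnerProductSpace Topology Pointwise ENNReal
open Filter Set MeasureTheory Metric

namespace Literature.MathematicalPhysics.StatisticalMechanics.KreutzZiereis2026

open Literature.MathematicalPhysics.StatisticalMechanics.CicaleseLeonardi2020 (latticeVoronoiCell)

variable {d : ℕ}

/-! ### §1 Ideal crystals (2.1), (L1)–(L4), Voronoi radii (2.2)–(2.3) -/

/-- The integer point `Σ_j k_j e_j ∈ ℤ^d ⊂ ℝ^d`. [cite: KreutzZiereis2026, (2.1) p. 4] -/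
def intPoint (k : Fin d → ℤ) : EuclideanSpace ℝ (Fin d) :=
  ∑ j, (k j : ℝ) • EuclideanSpace.single j (1 : ℝ)

/-- **(2.1) ideal crystal**: `𝓛 = ⋃_{i=1}^{l} (x_i + Lℤ^d)` for some `l ≥ 1`, points `x₁,…,x_l` and
`L ∈ GL(d,ℝ)` (a finite union of translates of one Bravais lattice; `l = 1`: Bravais lattices such as
`ℤ^d`, the triangular lattice, FCC; `l ≥ 2`: multilattices such as HCP).
[cite: KreutzZiereis2026, (2.1) p. 4] -/
def IsIdealCrystal (L : Set (EuclideanSpace ℝ (Fin d))) : Prop :=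
  ∃ (l : ℕ) (x : Fin (l + 1) → EuclideanSpace ℝ (Fin d))
    (M : EuclideanSpace ℝ (Fin d) ≃ₗ[ℝ] EuclideanSpace ℝ (Fin d)),
    L = ⋃ i, Set.range fun k : Fin d → ℤ => x i + M (intPoint k)

/-- **(L1) (Discreteness)**: "There exists `r > 0` such that for all `x ∈ ℝ^d` it holds
`#{B_r(x) ∩ 𝓛} ≤ 1`." [cite: KreutzZiereis2026, (L1) p. 4] -/
def L1 (L : Set (EuclideanSpace ℝ (Fin d))) : Prop :=
  ∃ r : ℝ, 0 < r ∧ ∀ x : EuclideanSpace ℝ (Fin d), (L ∩ ball x r).Subsingleton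

/-- **(L2) (No large empty regions)**: "There exists `R > 0` such that for all `x ∈ ℝ^d` it holds
`#{B_R(x) ∩ 𝓛} ≥ 1`." [cite: KreutzZiereis2026, (L2) p. 4] -/
def L2 (L : Set (EuclideanSpace ℝ (Fin d))) : Prop :=
  ∃ R : ℝ, 0 < R ∧ ∀ x : EuclideanSpace ℝ (Fin d), (L ∩ ball x R).Nonempty

/-- **(L3) (Periodicity)**: "Defining `v_i = Le_i` (`i = 1,…,d`) it holds `𝓛 + v_i = 𝓛`."
[cite: KreutzZiereis2026, (L3) p. 4] -/
def L3 (L : Set (EuclideanSpace ℝ (Fin d)))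
    (M : EuclideanSpace ℝ (Fin d) ≃ₗ[ℝ] EuclideanSpace ℝ (Fin d)) : Prop :=
  ∀ (i : Fin d) (p : EuclideanSpace ℝ (Fin d)), p ∈ L ↔ p + M (EuclideanSpace.single i (1 : ℝ)) ∈ L

/-- `SO(d)`: a linear isometry of `ℝ^d` of determinant `1`. [cite: KreutzZiereis2026, (L4) p. 4 and (E3), (E5) p. 5] -/
def IsRotation (R : EuclideanSpace ℝ (Fin d) ≃ₗᵢ[ℝ] EuclideanSpace ℝ (Fin d)) : Prop :=
  LinearMap.det (R.toLinearEquiv : EuclideanSpace ℝ (Fin d) →ₗ[ℝ] EuclideanSpace ℝ (Fin d)) = 1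

/-- **(L4) (Symmetry)**, rendered by its content: the group of rotations `Q ∈ SO(d)` with `Q𝓛 = 𝓛` is
finite (the source: "there exists a finite subgroup `G ⊂ SO(d)` such that `Q𝓛 = 𝓛` for all `Q ∈ G`",
with `𝔸 = SO(d)/G` the space of orientations, so `G` is the full rotational stabiliser).
[cite: KreutzZiereis2026, (L4) p. 4–5] -/
def L4 (L : Set (EuclideanSpace ℝ (Fin d))) : Prop :=
  {Q : EuclideanSpace ℝ (Fin d) ≃ₗᵢ[ℝ] EuclideanSpace ℝ (Fin d) | IsRotation Q ∧ Q '' L = L}.Finite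

/-- `R_V`, the outer radius of the Voronoi cells (2.2) (the tree's `latticeVoronoiCell`)
`V_𝓛(x) ⊆ B̄_{R_V}(x)`, "which we assume to be independent of `x ∈ 𝓛`" — here the supremum over all
cells of the circumradius. [cite: KreutzZiereis2026, (2.2)–(2.3) p. 4] -/
def outerRadius (L : Set (EuclideanSpace ℝ (Fin d))) : ℝ :=
  sSup {r | ∃ x ∈ L, ∃ y ∈ latticeVoronoiCell L x, r = dist x y}

/-- `S_V := sup{|x − y| : x, y ∈ 𝓛, H^{d−1}(V_𝓛(x) ∩ V_𝓛(y)) ≠ 0}`, the Voronoi relevant distance (for an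
ideal crystal the set is bounded, `S_V ≤ 2R_V`, Remark 2.1; `Real.sSup` of an unbounded set would be the
junk value `0`). [cite: KreutzZiereis2026, p. 4 (after (2.3)) and Remark 2.1 p. 7] -/
def voronoiRelevantDist (L : Set (EuclideanSpace ℝ (Fin d))) : ℝ :=
  sSup {r | ∃ x ∈ L, ∃ y ∈ L,
    μH[((d - 1 : ℕ) : ℝ)] (latticeVoronoiCell L x ∩ latticeVoronoiCell L y) ≠ 0 ∧ r = dist x y}

/-- An ideal crystal is periodic under the lattice vectors `v_i = Le_i` ((2.1) ⇒ (L3)), PROVED.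
[cite: KreutzZiereis2026, (L3) p. 4] -/
theorem isIdealCrystal_periodic {L : Set (EuclideanSpace ℝ (Fin d))} {l : ℕ}
    {x : Fin (l + 1) → EuclideanSpace ℝ (Fin d)}
    {M : EuclideanSpace ℝ (Fin d) ≃ₗ[ℝ] EuclideanSpace ℝ (Fin d)}
    (hL : L = ⋃ i, Set.range fun k : Fin d → ℤ => x i + M (intPoint k)) : L3 L M := by
  classical
  have key : ∀ (i : Fin d) (k : Fin d → ℤ),
      M (intPoint k) + M (EuclideanSpace.single i (1 : ℝ)) = M (intPoint (k + Pi.single i 1)) := by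
    intro i k
    rw [← map_add]
    congr 1
    simp only [intPoint, Pi.add_apply, Int.cast_add, add_smul, Finset.sum_add_distrib]
    congr 1
    rw [Finset.sum_eq_single i]
    · simp
    · intro j _ hj
      simp [hj]
    · simp
  intro i p
  subst hL
  simp only [Set.mem_iUnion, Set.mem_range]
  constructor
  · rintro ⟨j, k, rfl⟩
    exact ⟨j, k + Pi.single i 1, by rw [← key, add_assoc]⟩
  · rintro ⟨j, k, hk⟩
    refine ⟨j, k - Pi.single i 1, ?_⟩
    have h2 := key i (k - Pi.single i 1)
    rw [sub_add_cancel] at h2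
    have : x j + M (intPoint (k - Pi.single i 1)) + M (EuclideanSpace.single i (1 : ℝ)) =
        p + M (EuclideanSpace.single i (1 : ℝ)) := by rw [add_assoc, h2, hk]
    exact add_right_cancel this

/-! ### §2 Positioned crystals `𝓛_ε(z)` (2.6), configurations, cell energies (2.7)–(2.8) -/

/-- The positioned copies `R(𝓛 + τ)`, `R ∈ SO(d)`, `τ ∈ ℝ^d`, of the reference crystal — the lattices
`𝓛(z)`, `z ∈ 𝒵∖{0}`. [cite: KreutzZiereis2026, (2.5)–(2.6) p. 5] -/
def positionedCrystals (L : Set (EuclideanSpace ℝ (Fin d))) : Set (Set (EuclideanSpace ℝ (Fin d))) :=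
  {S | ∃ (R : EuclideanSpace ℝ (Fin d) ≃ₗᵢ[ℝ] EuclideanSpace ℝ (Fin d)) (τ : EuclideanSpace ℝ (Fin d)),
    IsRotation R ∧ S = (fun p => R (p + τ)) '' L}

/-- The phase space `𝒵 = (𝔸 × 𝕋 × {1}) ∪ {0}` (2.5) by representatives: `none` is the vacuum `0`,
`some (R, τ)` the positioned crystal `R(𝓛 + τ)` (`R` represents a class of `𝔸 = SO(d)/G`, `τ` a class
of `𝕋 = ℝ^d/𝓛`). [cite: KreutzZiereis2026, (2.5) p. 5] -/
abbrev Grain (d : ℕ) : Type :=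
  Option ((EuclideanSpace ℝ (Fin d) ≃ₗᵢ[ℝ] EuclideanSpace ℝ (Fin d)) × EuclideanSpace ℝ (Fin d))

/-- The rotation part of a non-vacuum phase lies in `SO(d)` (vacuum: no condition).
[cite: KreutzZiereis2026, (2.5) p. 5] -/
def Grain.IsSO : Grain d → Prop
  | none => True
  | some z => IsRotation z.1

/-- `𝓛_ε(z)`: `𝓛_ε(0) = ∅` and `𝓛_ε(R,τ,1) = εR(𝓛 + τ)`. [cite: KreutzZiereis2026, (2.6) p. 5] -/
def grainLattice (L : Set (EuclideanSpace ℝ (Fin d))) (ε : ℝ) :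
    Grain d → Set (EuclideanSpace ℝ (Fin d))
  | none => ∅
  | some z => (fun p => ε • z.1 (p + z.2)) '' L

/-- The vacuum has no atoms: `𝓛_ε(0) = ∅`. [cite: KreutzZiereis2026, (2.6) p. 5] -/
@[simp] theorem grainLattice_none (L : Set (EuclideanSpace ℝ (Fin d))) (ε : ℝ) :
    grainLattice L ε none = ∅ := rfl

/-- At `ε = 1` a non-vacuum phase with rotation part in `SO(d)` is one of the positioned crystals.
[cite: KreutzZiereis2026, (2.6) p. 5] -/
theorem grainLattice_one_mem {L : Set (EuclideanSpace ℝ (Fin d))}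
    {R : EuclideanSpace ℝ (Fin d) ≃ₗᵢ[ℝ] EuclideanSpace ℝ (Fin d)} {τ : EuclideanSpace ℝ (Fin d)}
    (hR : IsRotation R) : grainLattice L 1 (some (R, τ)) ∈ positionedCrystals L :=
  ⟨R, τ, hR, by simp [grainLattice]⟩

/-- `𝒩_ε(x) = {y ∈ X∖{x} : |x − y| ≤ εr_int}`, the neighbourhood of `x` (for `ε = 1` the `𝒩(x)` of
(E8)–(E10)). [cite: KreutzZiereis2026, (4.1) p. 15 and p. 6 (before (E8))] -/
def nbhd (rint ε : ℝ) (X : Set (EuclideanSpace ℝ (Fin d))) (x : EuclideanSpace ℝ (Fin d)) :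
    Set (EuclideanSpace ℝ (Fin d)) :=
  {y | y ∈ X ∧ y ≠ x ∧ dist x y ≤ ε * rint}

/-- The rescaled cell energy `E^ε_cell(x, X) := E_cell(x/ε, X/ε)`. [cite: KreutzZiereis2026, (2.7) p. 6] -/
def scaledCell (Ecell : EuclideanSpace ℝ (Fin d) → Set (EuclideanSpace ℝ (Fin d)) → ℝ≥0∞) (ε : ℝ)
    (x : EuclideanSpace ℝ (Fin d)) (X : Set (EuclideanSpace ℝ (Fin d))) : ℝ≥0∞ :=
  Ecell (ε⁻¹ • x) (ε⁻¹ • X)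

/-- The configurational energy in a Borel set `A`: `E_ε(X, A) := ε^{d−1} Σ_{x ∈ X ∩ A} E^ε_cell(x, X)`
(`E_ε(X) = E_ε(X, ℝ^d)` is `energy Ecell ε X univ`; a `finsum`, the source's `X` being finite; the
source has `d ≥ 2`, so the truncated exponent `d − 1 : ℕ` is the printed one).
[cite: KreutzZiereis2026, (2.8) p. 6] -/
def energy (Ecell : EuclideanSpace ℝ (Fin d) → Set (EuclideanSpace ℝ (Fin d)) → ℝ≥0∞) (ε : ℝ)
    (X A : Set (EuclideanSpace ℝ (Fin d))) : ℝ≥0∞ :=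
  ENNReal.ofReal (ε ^ (d - 1)) * ∑ᶠ x ∈ X ∩ A, scaledCell Ecell ε x X

/-- The empty configuration has zero energy. [cite: KreutzZiereis2026, (2.8) p. 6] -/
@[simp] theorem energy_empty (Ecell : EuclideanSpace ℝ (Fin d) → Set (EuclideanSpace ℝ (Fin d)) → ℝ≥0∞)
    (ε : ℝ) (A : Set (EuclideanSpace ℝ (Fin d))) : energy Ecell ε ∅ A = 0 := by
  simp [energy]

/-! ### §3 The cell-energy axioms (E1)–(E10) -/

/-- **(E1) (Discreteness)** "For every `X ∈ 𝒳` and `x ∈ X` we have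
`E_cell(x,X) < +∞ ⟺ dist({x}, X∖{x}) ≥ 1`." [cite: KreutzZiereis2026, (E1) p. 5] -/
def E1 (Ecell : EuclideanSpace ℝ (Fin d) → Set (EuclideanSpace ℝ (Fin d)) → ℝ≥0∞) : Prop :=
  ∀ (X : Set (EuclideanSpace ℝ (Fin d))) (x : EuclideanSpace ℝ (Fin d)), X.Finite → x ∈ X →
    (Ecell x X < ⊤ ↔ ∀ y ∈ X, y ≠ x → 1 ≤ dist x y)

/-- **(E2) (Boundedness)** "There exists `C > 0` such that for every `X ∈ 𝒳` and every `x ∈ X` with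
`E_cell(x,X) < +∞` we have `0 ≤ E_cell(x,X) ≤ C`." [cite: KreutzZiereis2026, (E2) p. 5] -/
def E2 (Ecell : EuclideanSpace ℝ (Fin d) → Set (EuclideanSpace ℝ (Fin d)) → ℝ≥0∞) : Prop :=
  ∃ C : ℝ, 0 < C ∧ ∀ (X : Set (EuclideanSpace ℝ (Fin d))) (x : EuclideanSpace ℝ (Fin d)), X.Finite →
    x ∈ X → Ecell x X < ⊤ → Ecell x X ≤ ENNReal.ofReal C

/-- **(E3) (Crystallization)** "There exists a radius `r_crys ≥ max{R_V, S_V} > 0` with the following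
property: For every `X ∈ 𝒳` and every `x ∈ X`, we have `E_cell(x,X) = 0 ⟺` there exists
`(R,τ) ∈ SO(d) × ℝ^d` such that `X ∩ B̄_{r_crys}(x) = R(𝓛 + τ) ∩ B̄_{r_crys}(x)`."
[cite: KreutzZiereis2026, (E3) p. 5] -/
def E3 (L : Set (EuclideanSpace ℝ (Fin d))) (rcrys : ℝ)
    (Ecell : EuclideanSpace ℝ (Fin d) → Set (EuclideanSpace ℝ (Fin d)) → ℝ≥0∞) : Prop :=
  max (outerRadius L) (voronoiRelevantDist L) ≤ rcrys ∧ 0 < rcrys ∧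
    ∀ (X : Set (EuclideanSpace ℝ (Fin d))) (x : EuclideanSpace ℝ (Fin d)), X.Finite → x ∈ X →
      (Ecell x X = 0 ↔ ∃ S ∈ positionedCrystals L, X ∩ closedBall x rcrys = S ∩ closedBall x rcrys)

/-- **(E4) (Locality)** "There exists `r_int ≥ r_crys > 0` with the following property. For every
`X, Y ∈ 𝒳` with `X ∩ B̄_{r_int}(x) = Y ∩ B̄_{r_int}(x)` we have `E_cell(x,X) = E_cell(x,Y)`."
[cite: KreutzZiereis2026, (E4) p. 5] -/
def E4 (rcrys rint : ℝ) (Ecell : EuclideanSpace ℝ (Fin d) → Set (EuclideanSpace ℝ (Fin d)) → ℝ≥0∞) : Prop :=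
  rcrys ≤ rint ∧ ∀ (X Y : Set (EuclideanSpace ℝ (Fin d))) (x : EuclideanSpace ℝ (Fin d)),
    X.Finite → Y.Finite → X ∩ closedBall x rint = Y ∩ closedBall x rint → Ecell x X = Ecell x Y

/-- **(E5) (Isometry invariance)** "For every `X ∈ 𝒳`, `x ∈ X` we have
`E_cell(x,X) = E_cell(Rx + τ, RX + τ)` for all `R ∈ SO(d)` and `τ ∈ ℝ^d`."
[cite: KreutzZiereis2026, (E5) p. 5] -/
def E5 (Ecell : EuclideanSpace ℝ (Fin d) → Set (EuclideanSpace ℝ (Fin d)) → ℝ≥0∞) : Prop :=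
  ∀ (X : Set (EuclideanSpace ℝ (Fin d))) (x : EuclideanSpace ℝ (Fin d)), X.Finite → x ∈ X →
    ∀ (R : EuclideanSpace ℝ (Fin d) ≃ₗᵢ[ℝ] EuclideanSpace ℝ (Fin d)) (τ : EuclideanSpace ℝ (Fin d)),
      IsRotation R → Ecell x X = Ecell (R x + τ) ((fun p => R p + τ) '' X)

/-- **(E6) (Coercivity)** "There exists `c > 0` such that for all `X ∈ 𝒳` and `x ∈ X` we have
`E_cell(x,X) > 0 ⟹ E_cell(x,X) ≥ c`." [cite: KreutzZiereis2026, (E6) p. 6] -/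
def E6 (Ecell : EuclideanSpace ℝ (Fin d) → Set (EuclideanSpace ℝ (Fin d)) → ℝ≥0∞) : Prop :=
  ∃ c : ℝ, 0 < c ∧ ∀ (X : Set (EuclideanSpace ℝ (Fin d))) (x : EuclideanSpace ℝ (Fin d)), X.Finite →
    x ∈ X → 0 < Ecell x X → ENNReal.ofReal c ≤ Ecell x X

/-- **(E7) (Local rigidity)** "Let `x, y ∈ X` satisfy `|x − y| ≤ r_crys` and
`E_cell(x,X) + E_cell(y,X) = 0`. Then `R_x = QR_y` for some `Q ∈ G` and `τ_x = Q⁻¹τ_y + RLz` for some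
`z ∈ ℤ^d` … In particular, we can choose `(R_x,τ_x) = (R_y,τ_y)`" — rendered: any crystal fits at `x` and
at `y` ((E3)) are the same positioned crystal. [cite: KreutzZiereis2026, (E7) p. 6] -/
def E7 (L : Set (EuclideanSpace ℝ (Fin d))) (rcrys : ℝ)
    (Ecell : EuclideanSpace ℝ (Fin d) → Set (EuclideanSpace ℝ (Fin d)) → ℝ≥0∞) : Prop :=
  ∀ (X : Set (EuclideanSpace ℝ (Fin d))) (x y : EuclideanSpace ℝ (Fin d)), X.Finite → x ∈ X → y ∈ X →
    dist x y ≤ rcrys → Ecell x X + Ecell y X = 0 →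
      ∀ Sx ∈ positionedCrystals L, ∀ Sy ∈ positionedCrystals L,
        X ∩ closedBall x rcrys = Sx ∩ closedBall x rcrys →
          X ∩ closedBall y rcrys = Sy ∩ closedBall y rcrys → Sx = Sy

/-- **(E8) (Unique interpolation)** "There exists `d_unique ∈ ℕ` such that if `{x} ∪ 𝒩(x) ⊂ 𝓛(z)` and
`#𝒩(x) ≥ d_unique`, then `z` is unique. Furthermore, for all `x ∈ X` with `#𝒩(x) < d_unique` we have
`E₁(X∖{x}) ≤ E₁(X)`." (`𝒩(x) = {y ∈ X∖{x} : |x−y| ≤ r_int}`.) [cite: KreutzZiereis2026, (E8) p. 6] -/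
def E8 (L : Set (EuclideanSpace ℝ (Fin d))) (rint : ℝ) (dunique : ℕ)
    (Ecell : EuclideanSpace ℝ (Fin d) → Set (EuclideanSpace ℝ (Fin d)) → ℝ≥0∞) : Prop :=
  (∀ (X : Set (EuclideanSpace ℝ (Fin d))) (x : EuclideanSpace ℝ (Fin d)), X.Finite → x ∈ X →
      dunique ≤ (nbhd rint 1 X x).ncard → ∀ S ∈ positionedCrystals L, ∀ S' ∈ positionedCrystals L,
        insert x (nbhd rint 1 X x) ⊆ S → insert x (nbhd rint 1 X x) ⊆ S' → S = S') ∧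
  ∀ (X : Set (EuclideanSpace ℝ (Fin d))) (x : EuclideanSpace ℝ (Fin d)), X.Finite → x ∈ X →
    (nbhd rint 1 X x).ncard < dunique → energy Ecell 1 (X \ {x}) univ ≤ energy Ecell 1 X univ

/-- **(E9) (Non-crystallized neighborhoods)** "For all `x ∈ X` such that for all `z ∈ 𝒵` it holds
`{x} ∪ 𝒩(x) ⊈ 𝓛(z)` we have `E₁(X∖{x}) ≤ E₁(X)`." [cite: KreutzZiereis2026, (E9) p. 6] -/
def E9 (L : Set (EuclideanSpace ℝ (Fin d))) (rint : ℝ)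
    (Ecell : EuclideanSpace ℝ (Fin d) → Set (EuclideanSpace ℝ (Fin d)) → ℝ≥0∞) : Prop :=
  ∀ (X : Set (EuclideanSpace ℝ (Fin d))) (x : EuclideanSpace ℝ (Fin d)), X.Finite → x ∈ X →
    (∀ S ∈ positionedCrystals L, ¬ insert x (nbhd rint 1 X x) ⊆ S) →
      energy Ecell 1 (X \ {x}) univ ≤ energy Ecell 1 X univ

/-- **(E10) (Highly coordinated neighbors)** "For all `x, y ∈ X` with `y ∈ 𝒩(x)`,
`min(#𝒩(x), #𝒩(y)) ≥ d_unique`, and `𝓛(z(x)) ≠ 𝓛(z(y))` we have `E₁(X∖{x}) ≤ E₁(X)`" (`𝓛(z(x))` = the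
positioned crystal containing `{x} ∪ 𝒩(x)`, unique by (E8)). [cite: KreutzZiereis2026, (E10) p. 6] -/
def E10 (L : Set (EuclideanSpace ℝ (Fin d))) (rint : ℝ) (dunique : ℕ)
    (Ecell : EuclideanSpace ℝ (Fin d) → Set (EuclideanSpace ℝ (Fin d)) → ℝ≥0∞) : Prop :=
  ∀ (X : Set (EuclideanSpace ℝ (Fin d))) (x y : EuclideanSpace ℝ (Fin d)), X.Finite → x ∈ X →
    y ∈ nbhd rint 1 X x → dunique ≤ min (nbhd rint 1 X x).ncard (nbhd rint 1 X y).ncard →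
      ∀ S ∈ positionedCrystals L, ∀ S' ∈ positionedCrystals L,
        insert x (nbhd rint 1 X x) ⊆ S → insert y (nbhd rint 1 X y) ⊆ S' → S ≠ S' →
          energy Ecell 1 (X \ {x}) univ ≤ energy Ecell 1 X univ

/-- "`E_cell` satisfies (E1)–(E10)" for the reference crystal `𝓛` with radii `r_crys ≤ r_int` and
coordination threshold `d_unique`. [cite: KreutzZiereis2026, §2.1 p. 5–6] -/
structure IsRigidCellEnergy (L : Set (EuclideanSpace ℝ (Fin d))) (rcrys rint : ℝ) (dunique : ℕ)
    (Ecell : EuclideanSpace ℝ (Fin d) → Set (EuclideanSpace ℝ (Fin d)) → ℝ≥0∞) : Prop where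
  e1 : E1 Ecell
  e2 : E2 Ecell
  e3 : E3 L rcrys Ecell
  e4 : E4 rcrys rint Ecell
  e5 : E5 Ecell
  e6 : E6 Ecell
  e7 : E7 L rcrys Ecell
  e8 : E8 L rint dunique Ecell
  e9 : E9 L rint Ecell
  e10 : E10 L rint dunique Ecell


/-! ### §4 Cubes `Q^ν_ρ(x)` and boundary layers (2.14), admissible configurations (Definition 2.2) -/

/-- `e_d`, the last standard basis vector (junk value `0` in dimension `0`).
[cite: KreutzZiereis2026, §2 (Notation) p. 4] -/
def eLast (d : ℕ) : EuclideanSpace ℝ (Fin d) :=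
  if h : 0 < d then EuclideanSpace.single (⟨d - 1, Nat.sub_lt h Nat.one_pos⟩ : Fin d) (1 : ℝ) else 0

/-- `R_ν`, "the orthogonal matrix induced by the linear mapping
`x ↦ 2(⟨x,ν⟩ + x_d)/|ν + e_d|² (ν + e_d) − x` if `ν ≠ −e_d`, `−x` otherwise", so that `R_ν e_d = ν`.
[cite: KreutzZiereis2026, §2.3 p. 8] -/
def rNu (ν : EuclideanSpace ℝ (Fin d)) (x : EuclideanSpace ℝ (Fin d)) : EuclideanSpace ℝ (Fin d) :=
  if ν = -eLast d then -x else (2 * ⟪x, ν + eLast d⟫_ℝ / ‖ν + eLast d‖ ^ 2) • (ν + eLast d) - x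

/-- Unfolding of `R_ν` off the exceptional direction. [cite: KreutzZiereis2026, §2.3 p. 8] -/
theorem rNu_of_ne {ν : EuclideanSpace ℝ (Fin d)} (hν : ν ≠ -eLast d) (x : EuclideanSpace ℝ (Fin d)) :
    rNu ν x = (2 * ⟪x, ν + eLast d⟫_ℝ / ‖ν + eLast d‖ ^ 2) • (ν + eLast d) - x := by
  simp [rNu, hν]

/-- `R_ν e_d = ν` for unit `ν` (off the exceptional direction `ν = −e_d`, where `R_ν = −id` gives the same),
PROVED. [cite: KreutzZiereis2026, §2.3 p. 8 ("In this way `R_ν e_d = ν`")] -/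
theorem rNu_eLast {ν : EuclideanSpace ℝ (Fin d)} (hd : 0 < d) (hν : ‖ν‖ = 1) : rNu ν (eLast d) = ν := by
  have he : ‖eLast d‖ = 1 := by
    simp [eLast, hd]
  by_cases h : ν = -eLast d
  · simp [rNu, h]
  · rw [rNu_of_ne h]
    have hne : ν + eLast d ≠ 0 := fun h0 => h (eq_neg_of_add_eq_zero_left h0)
    have hn : ‖ν + eLast d‖ ^ 2 = 2 * ⟪eLast d, ν + eLast d⟫_ℝ := by
      rw [← real_inner_self_eq_norm_sq, real_inner_add_add_self, inner_add_right,
        real_inner_self_eq_norm_sq, real_inner_self_eq_norm_sq, hν, he, real_inner_comm]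
      ring
    have hpos : ‖ν + eLast d‖ ^ 2 ≠ 0 := pow_ne_zero _ (norm_ne_zero_iff.2 hne)
    rw [← hn, div_self hpos, one_smul]
    abel

/-- The half-open unit cube `Q := {y : −½ ≤ ⟨y, e_i⟩ < ½, i = 1,…,d}`.
[cite: KreutzZiereis2026, §2.3 p. 8] -/
def unitCube (d : ℕ) : Set (EuclideanSpace ℝ (Fin d)) :=
  {y | ∀ i, -(1 / 2 : ℝ) ≤ y i ∧ y i < 1 / 2}

/-- `Q^ν_ρ(x) := x + ρQ^ν`, `Q^ν := R_ν Q`. [cite: KreutzZiereis2026, §2.3 p. 8] -/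
def cube (ν : EuclideanSpace ℝ (Fin d)) (ρ : ℝ) (x : EuclideanSpace ℝ (Fin d)) :
    Set (EuclideanSpace ℝ (Fin d)) :=
  (fun q => x + ρ • rNu ν q) '' unitCube d

/-- `∂_{λε}Q^ν_ρ(x) := Q^ν_{ρ+λε}(x) ∖ Q^ν_{ρ−λε}(x)`. [cite: KreutzZiereis2026, (2.14) p. 8] -/
def layer (ν : EuclideanSpace ℝ (Fin d)) (ρ lam ε : ℝ) (x : EuclideanSpace ℝ (Fin d)) :
    Set (EuclideanSpace ℝ (Fin d)) :=
  cube ν (ρ + lam * ε) x \ cube ν (ρ - lam * ε) x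

/-- `∂^+_{λε}Q^ν_ρ(x) = ∂_{λε}Q^ν_ρ(x) ∩ {z : ⟨z − x, ν⟩ ≥ r_int ε}`. [cite: KreutzZiereis2026, (2.14) p. 8] -/
def layerPlus (rint : ℝ) (ν : EuclideanSpace ℝ (Fin d)) (ρ lam ε : ℝ) (x : EuclideanSpace ℝ (Fin d)) :
    Set (EuclideanSpace ℝ (Fin d)) :=
  layer ν ρ lam ε x ∩ {z | rint * ε ≤ ⟪z - x, ν⟫_ℝ}

/-- `∂^−_{λε}Q^ν_ρ(x) = ∂_{λε}Q^ν_ρ(x) ∩ {z : −⟨z − x, ν⟩ ≥ r_int ε}`. [cite: KreutzZiereis2026, (2.14) p. 8] -/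
def layerMinus (rint : ℝ) (ν : EuclideanSpace ℝ (Fin d)) (ρ lam ε : ℝ) (x : EuclideanSpace ℝ (Fin d)) :
    Set (EuclideanSpace ℝ (Fin d)) :=
  layer ν ρ lam ε x ∩ {z | rint * ε ≤ -⟪z - x, ν⟫_ℝ}

/-- `∂^c_{λε}Q^ν_ρ(x) = ∂_{λε}Q^ν_ρ(x) ∖ (∂^+ ∪ ∂^−)`. [cite: KreutzZiereis2026, (2.14) p. 8] -/
def layerCompl (rint : ℝ) (ν : EuclideanSpace ℝ (Fin d)) (ρ lam ε : ℝ) (x : EuclideanSpace ℝ (Fin d)) :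
    Set (EuclideanSpace ℝ (Fin d)) :=
  layer ν ρ lam ε x \ (layerPlus rint ν ρ lam ε x ∪ layerMinus rint ν ρ lam ε x)

/-- **Definition 2.2**: `X ∈ Adm^{(z⁺,z⁻)}_{ε,λ}(Q^ν_ρ(x))` iff `X` is a configuration (finite) with
(i) `E_ε(X) < +∞`, (ii) `X = 𝓛_ε(z^±)` on `∂^±_{λε}Q^ν_ρ(x)`, (iii) `X = ∅` on `∂^c_{λε}Q^ν_ρ(x)`.
[cite: KreutzZiereis2026, Definition 2.2 p. 8–9] -/
structure IsAdm (L : Set (EuclideanSpace ℝ (Fin d))) (rint : ℝ)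
    (Ecell : EuclideanSpace ℝ (Fin d) → Set (EuclideanSpace ℝ (Fin d)) → ℝ≥0∞) (ε lam : ℝ)
    (zp zm : Grain d) (ν : EuclideanSpace ℝ (Fin d)) (ρ : ℝ) (x : EuclideanSpace ℝ (Fin d))
    (X : Set (EuclideanSpace ℝ (Fin d))) : Prop where
  finite : X.Finite
  energy_lt_top : energy Ecell ε X univ < ⊤
  plus : X ∩ layerPlus rint ν ρ lam ε x = grainLattice L ε zp ∩ layerPlus rint ν ρ lam ε x
  minus : X ∩ layerMinus rint ν ρ lam ε x = grainLattice L ε zm ∩ layerMinus rint ν ρ lam ε x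
  compl : X ∩ layerCompl rint ν ρ lam ε x = ∅

/-- `inf{E_ε(X, Q^ν_ρ(x₀)) : X ∈ Adm^{(z⁺,z⁻)}_{ε,λ}(Q^ν_ρ(x₀))}` (in `[0,+∞]`; `+∞` if nothing is admissible).
[cite: KreutzZiereis2026, (2.15) p. 9] -/
def cellInf (L : Set (EuclideanSpace ℝ (Fin d))) (rint : ℝ)
    (Ecell : EuclideanSpace ℝ (Fin d) → Set (EuclideanSpace ℝ (Fin d)) → ℝ≥0∞) (ε lam : ℝ)
    (zp zm : Grain d) (ν : EuclideanSpace ℝ (Fin d)) (ρ : ℝ) (x₀ : EuclideanSpace ℝ (Fin d)) : ℝ≥0∞ :=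
  sInf ((fun X => energy Ecell ε X (cube ν ρ x₀)) '' {X | IsAdm L rint Ecell ε lam zp zm ν ρ x₀ X})

/-- The infimum is below the energy of every admissible configuration. [cite: KreutzZiereis2026, (2.15) p. 9] -/
theorem cellInf_le {L : Set (EuclideanSpace ℝ (Fin d))} {rint : ℝ}
    {Ecell : EuclideanSpace ℝ (Fin d) → Set (EuclideanSpace ℝ (Fin d)) → ℝ≥0∞} {ε lam : ℝ}
    {zp zm : Grain d} {ν : EuclideanSpace ℝ (Fin d)} {ρ : ℝ} {x₀ : EuclideanSpace ℝ (Fin d)}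
    {X : Set (EuclideanSpace ℝ (Fin d))} (hX : IsAdm L rint Ecell ε lam zp zm ν ρ x₀ X) :
    cellInf L rint Ecell ε lam zp zm ν ρ x₀ ≤ energy Ecell ε X (cube ν ρ x₀) :=
  sInf_le ⟨X, hX, rfl⟩

/-! ### §5 The density `φ` (2.15), `φ_vac` (2.17), homogeneous extension -/

/-- The grain-boundary energy density `φ(z⁺, z⁻, ν)`, DEFINED as the upper limit as `ε → 0⁺` of the cell
infima on the unit cube `Q^ν_1(0)` with boundary-layer parameter `λ = 7r_int`; by Proposition 2.5 (the
named fact `KreutzZiereis2026_density`) it is the limit (2.15) for every centre, every `λ > 6r_int` and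
every `ρ > 0`. [cite: KreutzZiereis2026, Proposition 2.5 (2.15) p. 9] -/
def density (L : Set (EuclideanSpace ℝ (Fin d))) (rint : ℝ)
    (Ecell : EuclideanSpace ℝ (Fin d) → Set (EuclideanSpace ℝ (Fin d)) → ℝ≥0∞)
    (zp zm : Grain d) (ν : EuclideanSpace ℝ (Fin d)) : ℝ≥0∞ :=
  limsup (fun ε : ℝ => cellInf L rint Ecell ε (7 * rint) zp zm ν 1 0) (𝓝[>] (0 : ℝ))

/-- The extension of `ν ↦ φ(z⁺,z⁻,ν)` from `S^{d−1}` to `ℝ^d`, positively 1-homogeneous in `ν`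
(value `0` at `ν = 0`). [cite: KreutzZiereis2026, Theorem 2.8 (preamble) p. 10] -/
def densityHom (L : Set (EuclideanSpace ℝ (Fin d))) (rint : ℝ)
    (Ecell : EuclideanSpace ℝ (Fin d) → Set (EuclideanSpace ℝ (Fin d)) → ℝ≥0∞)
    (zp zm : Grain d) (v : EuclideanSpace ℝ (Fin d)) : ℝ≥0∞ :=
  if v = 0 then 0 else ENNReal.ofReal ‖v‖ * density L rint Ecell zp zm (‖v‖⁻¹ • v)

/-- **Definition 2.17**, the solid–vacuum density `φ_vac(z, ν) = φ(z, 0, ν)` (here its homogeneous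
extension to `ν ∈ ℝ^d`, as in Theorem 2.8 (iii)–(iv)). [cite: KreutzZiereis2026, (2.17) p. 10] -/
def phiVac (L : Set (EuclideanSpace ℝ (Fin d))) (rint : ℝ)
    (Ecell : EuclideanSpace ℝ (Fin d) → Set (EuclideanSpace ℝ (Fin d)) → ℝ≥0∞)
    (z : Grain d) (v : EuclideanSpace ℝ (Fin d)) : ℝ≥0∞ :=
  densityHom L rint Ecell z none v

/-- On the sphere the extension is the density itself. [cite: KreutzZiereis2026, Theorem 2.8 (preamble) p. 10] -/
theorem densityHom_of_norm_eq_one (L : Set (EuclideanSpace ℝ (Fin d))) (rint : ℝ)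
    (Ecell : EuclideanSpace ℝ (Fin d) → Set (EuclideanSpace ℝ (Fin d)) → ℝ≥0∞) (zp zm : Grain d)
    {ν : EuclideanSpace ℝ (Fin d)} (hν : ‖ν‖ = 1) :
    densityHom L rint Ecell zp zm ν = density L rint Ecell zp zm ν := by
  have h0 : ν ≠ 0 := by
    intro h; rw [h, norm_zero] at hν; exact zero_ne_one hν
  simp [densityHom, h0, hν]

/-- `φ_vac(z, ν) = φ(z, 0, ν)` on the sphere. [cite: KreutzZiereis2026, (2.17) p. 10] -/
theorem phiVac_eq (L : Set (EuclideanSpace ℝ (Fin d))) (rint : ℝ)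
    (Ecell : EuclideanSpace ℝ (Fin d) → Set (EuclideanSpace ℝ (Fin d)) → ℝ≥0∞) (z : Grain d)
    {ν : EuclideanSpace ℝ (Fin d)} (hν : ‖ν‖ = 1) :
    phiVac L rint Ecell z ν = density L rint Ecell z none ν :=
  densityHom_of_norm_eq_one L rint Ecell z none hν

/-! ### §6 The named facts (claims of an unrefereed preprint — never asserted) -/

/-- **Kreutz–Ziereis 2026, Proposition 2.5 (Density), NAMED CLAIM.**  Let `E_cell` satisfy (E1)–(E10)
for an ideal crystal `𝓛 ⊂ ℝ^d`, `d ≥ 2`.  For every `z⁺, z⁻ ∈ 𝒵`, `ν ∈ S^{d−1}`, `x₀ ∈ ℝ^d`, `λ > 6r_int`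
and `ρ > 0` the rescaled infima `ρ^{1−d} inf{E_ε(X, Q^ν_ρ(x₀)) : X ∈ Adm^{(z⁺,z⁻)}_{ε,λ}(Q^ν_ρ(x₀))}`
converge as `ε → 0`, to a limit `φ(z⁺,z⁻,ν)` independent of `x₀`, `λ` and `ρ` (rendered: they converge
to `density`, the upper limit at `x₀ = 0`, `ρ = 1`, `λ = 7r_int`).  Proved in the source in detail under
the standing assumption `r_crys ≥ 2R_V` of Remark 2.1, the general case being sketched there.
[claim: KreutzZiereis2026, status: under-review] [cite: KreutzZiereis2026, Proposition 2.5 (2.15) p. 9] -/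
def KreutzZiereis2026_density : Prop :=
  ∀ (d : ℕ) (L : Set (EuclideanSpace ℝ (Fin d))) (rcrys rint : ℝ) (dunique : ℕ)
    (Ecell : EuclideanSpace ℝ (Fin d) → Set (EuclideanSpace ℝ (Fin d)) → ℝ≥0∞),
    2 ≤ d → IsIdealCrystal L → IsRigidCellEnergy L rcrys rint dunique Ecell →
    ∀ (zp zm : Grain d) (ν x₀ : EuclideanSpace ℝ (Fin d)) (lam ρ : ℝ),
      zp.IsSO → zm.IsSO → ‖ν‖ = 1 → 6 * rint < lam → 0 < ρ →
        Tendsto (fun ε : ℝ => (ENNReal.ofReal (ρ ^ (d - 1)))⁻¹ * cellInf L rint Ecell ε lam zp zm ν ρ x₀)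
          (𝓝[>] (0 : ℝ)) (𝓝 (density L rint Ecell zp zm ν))

/-- **Kreutz–Ziereis 2026, Theorem 2.8 (i) (Solid–vacuum energy), NAMED CLAIM.**
"`φ(z,0,ν) = φ(0,z,−ν)` for all `z ∈ 𝒵∖{0}` and `ν ∈ S^{d−1}`."
[claim: KreutzZiereis2026, status: under-review] [cite: KreutzZiereis2026, Theorem 2.8 (i) p. 10] -/
def KreutzZiereis2026_solidVacuum : Prop :=
  ∀ (d : ℕ) (L : Set (EuclideanSpace ℝ (Fin d))) (rcrys rint : ℝ) (dunique : ℕ)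
    (Ecell : EuclideanSpace ℝ (Fin d) → Set (EuclideanSpace ℝ (Fin d)) → ℝ≥0∞),
    2 ≤ d → IsIdealCrystal L → IsRigidCellEnergy L rcrys rint dunique Ecell →
    ∀ (R : EuclideanSpace ℝ (Fin d) ≃ₗᵢ[ℝ] EuclideanSpace ℝ (Fin d)) (τ ν : EuclideanSpace ℝ (Fin d)),
      IsRotation R → ‖ν‖ = 1 →
        density L rint Ecell (some (R, τ)) none ν = density L rint Ecell none (some (R, τ)) (-ν)

/-- **Kreutz–Ziereis 2026, Theorem 2.8 (ii) (Solid–solid energy), NAMED CLAIM.**  "For all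
`z⁺, z⁻ ∈ 𝒵∖{0}`, `z⁺ ≠ z⁻` and `ν ∈ S^{d−1}` it holds `φ(z⁺,z⁻,ν) = φ_vac(z⁺,ν) + φ_vac(z⁻,−ν)`": a grain
boundary between two differently positioned copies of the crystal costs exactly the sum of the two
free-surface energies ("solid–solid phase transitions with interpolating boundary layers are not
energetically favorable", abstract).  `z⁺ ≠ z⁻` in `𝒵` is `𝓛(z⁺) ≠ 𝓛(z⁻)`.
[claim: KreutzZiereis2026, status: under-review] [cite: KreutzZiereis2026, Theorem 2.8 (ii) p. 10; Lemma 8.1 p. 32] -/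
def KreutzZiereis2026_solidSolid : Prop :=
  ∀ (d : ℕ) (L : Set (EuclideanSpace ℝ (Fin d))) (rcrys rint : ℝ) (dunique : ℕ)
    (Ecell : EuclideanSpace ℝ (Fin d) → Set (EuclideanSpace ℝ (Fin d)) → ℝ≥0∞),
    2 ≤ d → IsIdealCrystal L → IsRigidCellEnergy L rcrys rint dunique Ecell →
    ∀ (Rp Rm : EuclideanSpace ℝ (Fin d) ≃ₗᵢ[ℝ] EuclideanSpace ℝ (Fin d))
      (τp τm ν : EuclideanSpace ℝ (Fin d)), IsRotation Rp → IsRotation Rm →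
      grainLattice L 1 (some (Rp, τp)) ≠ grainLattice L 1 (some (Rm, τm)) → ‖ν‖ = 1 →
        density L rint Ecell (some (Rp, τp)) (some (Rm, τm)) ν =
          density L rint Ecell (some (Rp, τp)) none ν + density L rint Ecell (some (Rm, τm)) none (-ν)

/-- **Kreutz–Ziereis 2026, Theorem 2.8 (iii) (Convexity), NAMED CLAIM.**  "The mapping `ν ↦ φ_vac(z,ν)`
is convex for all `z ∈ 𝒵`" (the positively 1-homogeneous extension to `ℝ^d`; rendered on real values,
finite by (iv)). [claim: KreutzZiereis2026, status: under-review] [cite: KreutzZiereis2026, Theorem 2.8 (iii) p. 10] -/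
def KreutzZiereis2026_convex : Prop :=
  ∀ (d : ℕ) (L : Set (EuclideanSpace ℝ (Fin d))) (rcrys rint : ℝ) (dunique : ℕ)
    (Ecell : EuclideanSpace ℝ (Fin d) → Set (EuclideanSpace ℝ (Fin d)) → ℝ≥0∞),
    2 ≤ d → IsIdealCrystal L → IsRigidCellEnergy L rcrys rint dunique Ecell →
    ∀ z : Grain d, z.IsSO → ConvexOn ℝ univ fun v => (phiVac L rint Ecell z v).toReal

/-- **Kreutz–Ziereis 2026, Theorem 2.8 (iv) (Boundedness), NAMED CLAIM.**  "There exists `C > 0` such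
that `φ_vac(z,ν) ≤ C|ν|` for all `ν ∈ ℝ^d`" (hence `ν ↦ φ_vac(z,ν)` is Lipschitz).
[claim: KreutzZiereis2026, status: under-review] [cite: KreutzZiereis2026, Theorem 2.8 (iv) p. 10] -/
def KreutzZiereis2026_bounded : Prop :=
  ∀ (d : ℕ) (L : Set (EuclideanSpace ℝ (Fin d))) (rcrys rint : ℝ) (dunique : ℕ)
    (Ecell : EuclideanSpace ℝ (Fin d) → Set (EuclideanSpace ℝ (Fin d)) → ℝ≥0∞),
    2 ≤ d → IsIdealCrystal L → IsRigidCellEnergy L rcrys rint dunique Ecell →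
    ∃ C : ℝ, 0 < C ∧ ∀ (z : Grain d) (v : EuclideanSpace ℝ (Fin d)), z.IsSO →
      phiVac L rint Ecell z v ≤ ENNReal.ofReal (C * ‖v‖)

/-- **Kreutz–Ziereis 2026, Theorem 2.8 (v) (Translational invariance), NAMED CLAIM.**  "For all
`z = (R,τ,1) ∈ 𝒵`, `ν ∈ S^{d−1}` there holds `φ_vac((R,τ,1),ν) = φ_vac((R,0,1),ν)`."
[claim: KreutzZiereis2026, status: under-review] [cite: KreutzZiereis2026, Theorem 2.8 (v) p. 10] -/
def KreutzZiereis2026_translationInvariant : Prop :=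
  ∀ (d : ℕ) (L : Set (EuclideanSpace ℝ (Fin d))) (rcrys rint : ℝ) (dunique : ℕ)
    (Ecell : EuclideanSpace ℝ (Fin d) → Set (EuclideanSpace ℝ (Fin d)) → ℝ≥0∞),
    2 ≤ d → IsIdealCrystal L → IsRigidCellEnergy L rcrys rint dunique Ecell →
    ∀ (R : EuclideanSpace ℝ (Fin d) ≃ₗᵢ[ℝ] EuclideanSpace ℝ (Fin d)) (τ ν : EuclideanSpace ℝ (Fin d)),
      IsRotation R → ‖ν‖ = 1 →
        density L rint Ecell (some (R, τ)) none ν = density L rint Ecell (some (R, 0)) none ν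

/-- **Kreutz–Ziereis 2026, Theorem 2.8 (vi) (Rotational invariance), NAMED CLAIM.**  "For all
`z = (R,τ,1)`, `ν ∈ S^{d−1}` and `O ∈ SO(d)` there holds `φ_vac((OR,0,1),Oν) = φ_vac((R,0,1),ν)`"
(`OR` = first `R`, then `O`). [claim: KreutzZiereis2026, status: under-review] [cite: KreutzZiereis2026, Theorem 2.8 (vi) p. 10] -/
def KreutzZiereis2026_rotationInvariant : Prop :=
  ∀ (d : ℕ) (L : Set (EuclideanSpace ℝ (Fin d))) (rcrys rint : ℝ) (dunique : ℕ)
    (Ecell : EuclideanSpace ℝ (Fin d) → Set (EuclideanSpace ℝ (Fin d)) → ℝ≥0∞),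
    2 ≤ d → IsIdealCrystal L → IsRigidCellEnergy L rcrys rint dunique Ecell →
    ∀ (R O : EuclideanSpace ℝ (Fin d) ≃ₗᵢ[ℝ] EuclideanSpace ℝ (Fin d)) (ν : EuclideanSpace ℝ (Fin d)),
      IsRotation R → IsRotation O → ‖ν‖ = 1 →
        density L rint Ecell (some (R.trans O, 0)) none (O ν) = density L rint Ecell (some (R, 0)) none ν

/-- **Kreutz–Ziereis 2026, Lemma 6.1 (reduction to subsets of two lattices), NAMED CLAIM** — the
structural mechanism behind Theorem 2.8 (ii): at lattice spacing `1`, on a cube of side `T` with boundary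
data `z⁺` (upper layer) and `z⁻` (lower layer), `λ > 8r_int`, every competitor `X` of the cell problem
contains two configurations `X⁺ ⊂ 𝓛(z⁺)`, `X⁻ ⊂ 𝓛(z⁻)` at mutual distance `> r_int`, admissible for the
solid–vacuum problems with the thinner layer parameter `λ̂ = λ − 2r_int`, whose energies add up to at most
the energy of `X` ("no interpolating boundary layers").
[claim: KreutzZiereis2026, status: under-review] [cite: KreutzZiereis2026, Lemma 6.1 p. 24] -/
def KreutzZiereis2026_twoLattices : Prop :=
  ∀ (d : ℕ) (L : Set (EuclideanSpace ℝ (Fin d))) (rcrys rint : ℝ) (dunique : ℕ)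
    (Ecell : EuclideanSpace ℝ (Fin d) → Set (EuclideanSpace ℝ (Fin d)) → ℝ≥0∞),
    2 ≤ d → IsIdealCrystal L → IsRigidCellEnergy L rcrys rint dunique Ecell →
    ∀ (zp zm : Grain d) (ν x₀ : EuclideanSpace ℝ (Fin d)) (lam T : ℝ), zp.IsSO → zm.IsSO →
      ‖ν‖ = 1 → 8 * rint < lam → 0 < T →
      ∀ X : Set (EuclideanSpace ℝ (Fin d)), IsAdm L rint Ecell 1 lam zp zm ν T x₀ X →
        ∃ Xp Xm : Set (EuclideanSpace ℝ (Fin d)), Xp ⊆ X ∧ Xm ⊆ X ∧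
          Xp ⊆ grainLattice L 1 zp ∧ Xm ⊆ grainLattice L 1 zm ∧
          (∀ p ∈ Xp, ∀ q ∈ Xm, rint < dist p q) ∧
          IsAdm L rint Ecell 1 (lam - 2 * rint) zp none ν T x₀ Xp ∧
          IsAdm L rint Ecell 1 (lam - 2 * rint) none zm ν T x₀ Xm ∧
          energy Ecell 1 Xp (cube ν T x₀) + energy Ecell 1 Xm (cube ν T x₀) ≤ energy Ecell 1 X (cube ν T x₀)

/-! ### §7 Proved corollaries of the claims (conditional theorems) -/

/-- Under Theorem 2.8 (i)+(ii): a grain boundary between two differently positioned crystals costs the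
free surface of the upper grain plus the free surface of the lower grain seen from below — in the
`φ(·,0,·)`/`φ(0,·,·)` form `φ(z⁺,z⁻,ν) = φ(z⁺,0,ν) + φ(0,z⁻,ν)`.
[cite: KreutzZiereis2026, Theorem 2.8 (i)–(ii) p. 10] -/
theorem density_eq_upper_add_lower (h₁ : KreutzZiereis2026_solidVacuum) (h₂ : KreutzZiereis2026_solidSolid)
    {d : ℕ} {L : Set (EuclideanSpace ℝ (Fin d))} {rcrys rint : ℝ} {dunique : ℕ}
    {Ecell : EuclideanSpace ℝ (Fin d) → Set (EuclideanSpace ℝ (Fin d)) → ℝ≥0∞}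
    (hd : 2 ≤ d) (hL : IsIdealCrystal L) (hE : IsRigidCellEnergy L rcrys rint dunique Ecell)
    {Rp Rm : EuclideanSpace ℝ (Fin d) ≃ₗᵢ[ℝ] EuclideanSpace ℝ (Fin d)} {τp τm ν : EuclideanSpace ℝ (Fin d)}
    (hRp : IsRotation Rp) (hRm : IsRotation Rm)
    (hne : grainLattice L 1 (some (Rp, τp)) ≠ grainLattice L 1 (some (Rm, τm))) (hν : ‖ν‖ = 1) :
    density L rint Ecell (some (Rp, τp)) (some (Rm, τm)) ν =
      density L rint Ecell (some (Rp, τp)) none ν + density L rint Ecell none (some (Rm, τm)) ν := by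
  rw [h₂ d L rcrys rint dunique Ecell hd hL hE Rp Rm τp τm ν hRp hRm hne hν]
  have hν' : ‖-ν‖ = 1 := by rw [norm_neg, hν]
  rw [h₁ d L rcrys rint dunique Ecell hd hL hE Rm τm (-ν) hRm hν', neg_neg]

/-! ### §8 Appendix A.1: the sticky cell energy with an angular term on `ℤ^d`; (E10) fails on `ℤ³` -/

/-- `ℤ^d ⊂ ℝ^d`, the reference crystal of Appendix A.1. [cite: KreutzZiereis2026, Appendix A.1 p. 34] -/
def intLattice (d : ℕ) : Set (EuclideanSpace ℝ (Fin d)) := Set.range (intPoint (d := d))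

/-- `ℤ^d` is an ideal crystal (2.1) with one coset (`l = 1`, `x₁ = 0`, `L = id`), PROVED.
[cite: KreutzZiereis2026, Appendix A.1 p. 34 ("clearly fulfills the conditions (L1)-(L4)")] -/
theorem isIdealCrystal_intLattice (d : ℕ) : IsIdealCrystal (intLattice d) := by
  refine ⟨0, fun _ => 0, LinearEquiv.refl ℝ _, ?_⟩
  ext p
  simp [intLattice]

/-- The ordered pairs of distinct neighbours `y, z ∈ 𝒩(x)` whose angle `θ_{yxz}` is NOT a multiple of
`π/2`: for unit bond vectors this is `⟨y − x, z − x⟩ ∉ {0, −1}` (the pairs charged `C_{V₃}` by (A.3)).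
[cite: KreutzZiereis2026, (A.2)–(A.3) p. 34] -/
def badAnglePairs {d : ℕ} (X : Set (EuclideanSpace ℝ (Fin d))) (x : EuclideanSpace ℝ (Fin d)) :
    Set (EuclideanSpace ℝ (Fin d) × EuclideanSpace ℝ (Fin d)) :=
  {p | p.1 ∈ nbhd 1 1 X x ∧ p.2 ∈ nbhd 1 1 X x ∧ p.1 ≠ p.2 ∧ ⟪p.1 - x, p.2 - x⟫_ℝ ≠ 0 ∧
    ⟪p.1 - x, p.2 - x⟫_ℝ ≠ -1}

/-- **(A.2)–(A.3)**, the cell energy of Appendix A.1 on `ℤ^d` (`r_int = r_crys = 1`, `𝒩(x) = 𝒩₁(x)`):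
`E_cell(x,X) = ½((2d − #𝒩₁(x)) + Σ_{y,z∈𝒩(x), y≠z} V₃(θ_{yxz}))` if `dist({x}, X∖{x}) ≥ 1`, `+∞` otherwise,
with `V₃ = 0` on multiples of `π/2` and `= C_{V₃}` otherwise (so the sum is `C_{V₃} · #badAnglePairs`).
[cite: KreutzZiereis2026, (A.2)–(A.3) p. 34] -/
def stickyAngularCell (d : ℕ) (C : ℝ) (x : EuclideanSpace ℝ (Fin d)) (X : Set (EuclideanSpace ℝ (Fin d))) :
    ℝ≥0∞ := by
  classical
  exact if (∀ y ∈ X, y ≠ x → 1 ≤ dist x y) then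
    ENNReal.ofReal (1 / 2 * ((2 * (d : ℝ) - ((nbhd 1 1 X x).ncard : ℝ)) +
      C * ((badAnglePairs X x).ncard : ℝ))) else ⊤

/-- Evaluation of (A.2) at a hard-core atom with neighbour set `T` and no charged angle.
[cite: KreutzZiereis2026, (A.2) p. 34] -/
theorem stickyAngularCell_eq {d : ℕ} {C : ℝ} {x : EuclideanSpace ℝ (Fin d)}
    {X : Set (EuclideanSpace ℝ (Fin d))} (hhc : ∀ y ∈ X, y ≠ x → 1 ≤ dist x y)
    (k : ℕ) (hk : (nbhd 1 1 X x).ncard = k) (hbad : badAnglePairs X x = ∅) :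
    stickyAngularCell d C x X = ENNReal.ofReal (1 / 2 * (2 * (d : ℝ) - k)) := by
  unfold stickyAngularCell
  rw [if_pos hhc, hk, hbad, Set.ncard_empty]
  simp

/-- The total energy (2.8) at `ε = 1` is the plain sum of the cell energies. [cite: KreutzZiereis2026, (2.8) p. 6] -/
theorem energy_one_univ {d : ℕ}
    (Ecell : EuclideanSpace ℝ (Fin d) → Set (EuclideanSpace ℝ (Fin d)) → ℝ≥0∞)
    (X : Set (EuclideanSpace ℝ (Fin d))) : energy Ecell 1 X univ = ∑ᶠ x ∈ X, Ecell x X := by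
  unfold energy scaledCell
  simp

/-! #### The seven-point configuration of Appendix A.1 (`d = 3`) -/

/-- Points of `ℝ³` from coordinates. [cite: KreutzZiereis2026, Appendix A.1 p. 35] -/
def mk3 (a b c : ℝ) : EuclideanSpace ℝ (Fin 3) := WithLp.toLp 2 ![a, b, c]

/-- First coordinate of `mk3`. [cite: KreutzZiereis2026, Appendix A.1 p. 35] -/
@[simp] theorem mk3_apply_zero (a b c : ℝ) : mk3 a b c 0 = a := rfl
/-- Second coordinate of `mk3`. [cite: KreutzZiereis2026, Appendix A.1 p. 35] -/
@[simp] theorem mk3_apply_one (a b c : ℝ) : mk3 a b c 1 = b := rfl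
/-- Third coordinate of `mk3`. [cite: KreutzZiereis2026, Appendix A.1 p. 35] -/
@[simp] theorem mk3_apply_two (a b c : ℝ) : mk3 a b c 2 = c := rfl

/-- Squared distances in coordinates. [cite: KreutzZiereis2026, Appendix A.1 p. 35] -/
theorem dist_mk3_sq (a b c a' b' c' : ℝ) :
    dist (mk3 a b c) (mk3 a' b' c') ^ 2 = (a - a') ^ 2 + (b - b') ^ 2 + (c - c') ^ 2 := by
  rw [EuclideanSpace.dist_eq, Fin.sum_univ_three, Real.sq_sqrt (by positivity)]
  simp [mk3, Real.dist_eq, sq_abs]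

/-- Inner products in coordinates. [cite: KreutzZiereis2026, Appendix A.1 p. 35] -/
theorem inner_mk3 (a b c a' b' c' : ℝ) : ⟪mk3 a b c, mk3 a' b' c'⟫_ℝ = a * a' + b * b' + c * c' := by
  simp [mk3, PiLp.inner_apply, Fin.sum_univ_three, mul_comm]

/-- Coordinatewise subtraction. [cite: KreutzZiereis2026, Appendix A.1 p. 35] -/
theorem mk3_sub (a b c a' b' c' : ℝ) : mk3 a b c - mk3 a' b' c' = mk3 (a - a') (b - b') (c - c') := by
  ext i; fin_cases i <;> simp [mk3]

/-- Two points agree iff their coordinates agree. [cite: KreutzZiereis2026, Appendix A.1 p. 35] -/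
theorem mk3_eq_iff (a b c a' b' c' : ℝ) : mk3 a b c = mk3 a' b' c' ↔ a = a' ∧ b = b' ∧ c = c' := by
  constructor
  · intro h
    have h0 := congrArg (fun p : EuclideanSpace ℝ (Fin 3) => p 0) h
    have h1 := congrArg (fun p : EuclideanSpace ℝ (Fin 3) => p 1) h
    have h2 := congrArg (fun p : EuclideanSpace ℝ (Fin 3) => p 2) h
    simp only [mk3_apply_zero, mk3_apply_one, mk3_apply_two] at h0 h1 h2
    exact ⟨h0, h1, h2⟩
  · rintro ⟨rfl, rfl, rfl⟩; rfl

/-- In `d = 3` the integer points are `mk3 k₀ k₁ k₂`. [cite: KreutzZiereis2026, (2.1) p. 4] -/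
theorem intPoint_three (k : Fin 3 → ℤ) : intPoint k = mk3 (k 0) (k 1) (k 2) := by
  ext i
  fin_cases i <;> simp [intPoint, mk3, Fin.sum_univ_three]

/-- `s = √2/2 = cos(π/4) = sin(π/4)`. [cite: KreutzZiereis2026, Appendix A.1 p. 35 ("`R` is a `π/4`-rotation")] -/
def sHalf : ℝ := Real.sqrt 2 / 2

/-- `2s² = 1` for `s = √2/2`. [cite: KreutzZiereis2026, Appendix A.1 p. 35] -/
theorem two_mul_sHalf_sq : 2 * sHalf ^ 2 = 1 := by
  have h : Real.sqrt 2 ^ 2 = 2 := Real.sq_sqrt (by norm_num)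
  unfold sHalf; nlinarith [h]

/-- `s² = ½`. [cite: KreutzZiereis2026, Appendix A.1 p. 35] -/
theorem sHalf_sq : sHalf ^ 2 = 1 / 2 := by linarith [two_mul_sHalf_sq]

/-- `s > 0`. [cite: KreutzZiereis2026, Appendix A.1 p. 35] -/
theorem sHalf_pos : 0 < sHalf := by
  unfold sHalf; exact div_pos (Real.sqrt_pos.2 (by norm_num)) (by norm_num)

/-- `s < 1`. [cite: KreutzZiereis2026, Appendix A.1 p. 35] -/
theorem sHalf_lt_one : sHalf < 1 := by nlinarith [sHalf_sq, sHalf_pos]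


/-- The seven points `0, e₃, 2e₃, e₃ + e₁, e₃ − e₁, Re₁, −Re₁` (`R` the `π/4`-rotation in the `xy`-plane)
of the `ℤ³` counterexample to (E10). [cite: KreutzZiereis2026, Appendix A.1 p. 35] -/
def p0 : EuclideanSpace ℝ (Fin 3) := mk3 0 0 0
/-- `e₃`. [cite: KreutzZiereis2026, Appendix A.1 p. 35] -/
def p1 : EuclideanSpace ℝ (Fin 3) := mk3 0 0 1
/-- `2e₃`. [cite: KreutzZiereis2026, Appendix A.1 p. 35] -/
def p2 : EuclideanSpace ℝ (Fin 3) := mk3 0 0 2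
/-- `e₃ + e₁`. [cite: KreutzZiereis2026, Appendix A.1 p. 35] -/
def p3 : EuclideanSpace ℝ (Fin 3) := mk3 1 0 1
/-- `e₃ − e₁`. [cite: KreutzZiereis2026, Appendix A.1 p. 35] -/
def p4 : EuclideanSpace ℝ (Fin 3) := mk3 (-1) 0 1
/-- `Re₁ = (√2/2, √2/2, 0)`. [cite: KreutzZiereis2026, Appendix A.1 p. 35] -/
def p5 : EuclideanSpace ℝ (Fin 3) := mk3 sHalf sHalf 0
/-- `−Re₁`. [cite: KreutzZiereis2026, Appendix A.1 p. 35] -/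
def p6 : EuclideanSpace ℝ (Fin 3) := mk3 (-sHalf) (-sHalf) 0

/-- `X = {0, e₃, 2e₃, e₃ + e₁, e₃ − e₁, Re₁, −Re₁}`. [cite: KreutzZiereis2026, Appendix A.1 p. 35] -/
def sevenPoints : Set (EuclideanSpace ℝ (Fin 3)) := {p0, p1, p2, p3, p4, p5, p6}

/-- `X ∖ {e₃}`. [cite: KreutzZiereis2026, Appendix A.1 p. 35] -/
def sixPoints : Set (EuclideanSpace ℝ (Fin 3)) := {p0, p2, p3, p4, p5, p6}

section Distances

/-! Squared distances between the seven points (`s² = ½`): the unit bonds are `0–e₃`, `0–(±Re₁)`,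
`e₃–2e₃`, `e₃–(e₃±e₁)`; all other pairs are at distance `> 1`. -/

/-- Elementary: unit distance from unit squared distance. [folklore] -/
private theorem le_one_of_sq {p q : EuclideanSpace ℝ (Fin 3)} (h : dist p q ^ 2 = 1) :
    dist p q ≤ 1 ∧ 1 ≤ dist p q := by
  have h0 : 0 ≤ dist p q := dist_nonneg
  constructor <;> nlinarith [h, h0]

/-- Elementary: a bound on `dist` from its square. [folklore] -/
private theorem one_lt_of_sq {p q : EuclideanSpace ℝ (Fin 3)} {v : ℝ} (h : dist p q ^ 2 = v) (hv : 1 < v) :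
    1 < dist p q := by
  have h0 : 0 ≤ dist p q := dist_nonneg
  nlinarith [h, h0]

/-- The distance between `0` and `e₃` compared with `1`. [cite: KreutzZiereis2026, Appendix A.1 p. 35] -/
theorem d01 : dist p0 p1 ≤ 1 ∧ 1 ≤ dist p0 p1 := le_one_of_sq (by rw [p0, p1, dist_mk3_sq]; norm_num)
/-- The distance between `0` and `Re₁` compared with `1`. [cite: KreutzZiereis2026, Appendix A.1 p. 35] -/
theorem d05 : dist p0 p5 ≤ 1 ∧ 1 ≤ dist p0 p5 :=
  le_one_of_sq (by rw [p0, p5, dist_mk3_sq]; nlinarith [sHalf_sq])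
/-- The distance between `0` and `−Re₁` compared with `1`. [cite: KreutzZiereis2026, Appendix A.1 p. 35] -/
theorem d06 : dist p0 p6 ≤ 1 ∧ 1 ≤ dist p0 p6 :=
  le_one_of_sq (by rw [p0, p6, dist_mk3_sq]; nlinarith [sHalf_sq])
/-- The distance between `e₃` and `2e₃` compared with `1`. [cite: KreutzZiereis2026, Appendix A.1 p. 35] -/
theorem d12 : dist p1 p2 ≤ 1 ∧ 1 ≤ dist p1 p2 := le_one_of_sq (by rw [p1, p2, dist_mk3_sq]; norm_num)
/-- The distance between `e₃` and `e₃+e₁` compared with `1`. [cite: KreutzZiereis2026, Appendix A.1 p. 35] -/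
theorem d13 : dist p1 p3 ≤ 1 ∧ 1 ≤ dist p1 p3 := le_one_of_sq (by rw [p1, p3, dist_mk3_sq]; norm_num)
/-- The distance between `e₃` and `e₃−e₁` compared with `1`. [cite: KreutzZiereis2026, Appendix A.1 p. 35] -/
theorem d14 : dist p1 p4 ≤ 1 ∧ 1 ≤ dist p1 p4 := le_one_of_sq (by rw [p1, p4, dist_mk3_sq]; norm_num)
/-- The distance between `0` and `2e₃` compared with `1`. [cite: KreutzZiereis2026, Appendix A.1 p. 35] -/
theorem d02 : 1 < dist p0 p2 := one_lt_of_sq (by rw [p0, p2, dist_mk3_sq]) (by norm_num)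
/-- The distance between `0` and `e₃+e₁` compared with `1`. [cite: KreutzZiereis2026, Appendix A.1 p. 35] -/
theorem d03 : 1 < dist p0 p3 := one_lt_of_sq (by rw [p0, p3, dist_mk3_sq]) (by norm_num)
/-- The distance between `0` and `e₃−e₁` compared with `1`. [cite: KreutzZiereis2026, Appendix A.1 p. 35] -/
theorem d04 : 1 < dist p0 p4 := one_lt_of_sq (by rw [p0, p4, dist_mk3_sq]) (by norm_num)
/-- The distance between `e₃` and `Re₁` compared with `1`. [cite: KreutzZiereis2026, Appendix A.1 p. 35] -/
theorem d15 : 1 < dist p1 p5 :=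
  one_lt_of_sq (v := 2) (by rw [p1, p5, dist_mk3_sq]; nlinarith [sHalf_sq]) (by norm_num)
/-- The distance between `e₃` and `−Re₁` compared with `1`. [cite: KreutzZiereis2026, Appendix A.1 p. 35] -/
theorem d16 : 1 < dist p1 p6 :=
  one_lt_of_sq (v := 2) (by rw [p1, p6, dist_mk3_sq]; nlinarith [sHalf_sq]) (by norm_num)
/-- The distance between `2e₃` and `e₃+e₁` compared with `1`. [cite: KreutzZiereis2026, Appendix A.1 p. 35] -/
theorem d23 : 1 < dist p2 p3 := one_lt_of_sq (by rw [p2, p3, dist_mk3_sq]) (by norm_num)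
/-- The distance between `2e₃` and `e₃−e₁` compared with `1`. [cite: KreutzZiereis2026, Appendix A.1 p. 35] -/
theorem d24 : 1 < dist p2 p4 := one_lt_of_sq (by rw [p2, p4, dist_mk3_sq]) (by norm_num)
/-- The distance between `2e₃` and `Re₁` compared with `1`. [cite: KreutzZiereis2026, Appendix A.1 p. 35] -/
theorem d25 : 1 < dist p2 p5 :=
  one_lt_of_sq (v := 5) (by rw [p2, p5, dist_mk3_sq]; nlinarith [sHalf_sq]) (by norm_num)
/-- The distance between `2e₃` and `−Re₁` compared with `1`. [cite: KreutzZiereis2026, Appendix A.1 p. 35] -/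
theorem d26 : 1 < dist p2 p6 :=
  one_lt_of_sq (v := 5) (by rw [p2, p6, dist_mk3_sq]; nlinarith [sHalf_sq]) (by norm_num)
/-- The distance between `e₃+e₁` and `e₃−e₁` compared with `1`. [cite: KreutzZiereis2026, Appendix A.1 p. 35] -/
theorem d34 : 1 < dist p3 p4 := one_lt_of_sq (by rw [p3, p4, dist_mk3_sq]) (by norm_num)
/-- The distance between `e₃+e₁` and `Re₁` compared with `1`. [cite: KreutzZiereis2026, Appendix A.1 p. 35] -/
theorem d35 : 1 < dist p3 p5 :=
  one_lt_of_sq (v := 3 - 2 * sHalf) (by rw [p3, p5, dist_mk3_sq]; nlinarith [sHalf_sq])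
    (by nlinarith [sHalf_lt_one])
/-- The distance between `e₃+e₁` and `−Re₁` compared with `1`. [cite: KreutzZiereis2026, Appendix A.1 p. 35] -/
theorem d36 : 1 < dist p3 p6 :=
  one_lt_of_sq (v := 3 + 2 * sHalf) (by rw [p3, p6, dist_mk3_sq]; nlinarith [sHalf_sq])
    (by nlinarith [sHalf_pos])
/-- The distance between `e₃−e₁` and `Re₁` compared with `1`. [cite: KreutzZiereis2026, Appendix A.1 p. 35] -/
theorem d45 : 1 < dist p4 p5 :=
  one_lt_of_sq (v := 3 + 2 * sHalf) (by rw [p4, p5, dist_mk3_sq]; nlinarith [sHalf_sq])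
    (by nlinarith [sHalf_pos])
/-- The distance between `e₃−e₁` and `−Re₁` compared with `1`. [cite: KreutzZiereis2026, Appendix A.1 p. 35] -/
theorem d46 : 1 < dist p4 p6 :=
  one_lt_of_sq (v := 3 - 2 * sHalf) (by rw [p4, p6, dist_mk3_sq]; nlinarith [sHalf_sq])
    (by nlinarith [sHalf_lt_one])
/-- The distance between `Re₁` and `−Re₁` compared with `1`. [cite: KreutzZiereis2026, Appendix A.1 p. 35] -/
theorem d56 : 1 < dist p5 p6 :=
  one_lt_of_sq (v := 4) (by rw [p5, p6, dist_mk3_sq]; nlinarith [sHalf_sq]) (by norm_num)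

end Distances

section Distinctness

/-- `0 ≠ e₃`. [cite: KreutzZiereis2026, Appendix A.1 p. 35] -/
theorem ne01 : p0 ≠ p1 := by
  rw [p0, p1]; intro h; rw [mk3_eq_iff] at h; rcases h with ⟨h1, h2, h3⟩; linarith [sHalf_pos]

/-- `0 ≠ 2e₃`. [cite: KreutzZiereis2026, Appendix A.1 p. 35] -/
theorem ne02 : p0 ≠ p2 := by
  rw [p0, p2]; intro h; rw [mk3_eq_iff] at h; rcases h with ⟨h1, h2, h3⟩; linarith [sHalf_pos]

/-- `0 ≠ e₃+e₁`. [cite: KreutzZiereis2026, Appendix A.1 p. 35] -/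
theorem ne03 : p0 ≠ p3 := by
  rw [p0, p3]; intro h; rw [mk3_eq_iff] at h; rcases h with ⟨h1, h2, h3⟩; linarith [sHalf_pos]

/-- `0 ≠ e₃−e₁`. [cite: KreutzZiereis2026, Appendix A.1 p. 35] -/
theorem ne04 : p0 ≠ p4 := by
  rw [p0, p4]; intro h; rw [mk3_eq_iff] at h; rcases h with ⟨h1, h2, h3⟩; linarith [sHalf_pos]

/-- `0 ≠ Re₁`. [cite: KreutzZiereis2026, Appendix A.1 p. 35] -/
theorem ne05 : p0 ≠ p5 := by
  rw [p0, p5]; intro h; rw [mk3_eq_iff] at h; rcases h with ⟨h1, h2, h3⟩; linarith [sHalf_pos]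

/-- `0 ≠ −Re₁`. [cite: KreutzZiereis2026, Appendix A.1 p. 35] -/
theorem ne06 : p0 ≠ p6 := by
  rw [p0, p6]; intro h; rw [mk3_eq_iff] at h; rcases h with ⟨h1, h2, h3⟩; linarith [sHalf_pos]

/-- `e₃ ≠ 2e₃`. [cite: KreutzZiereis2026, Appendix A.1 p. 35] -/
theorem ne12 : p1 ≠ p2 := by
  rw [p1, p2]; intro h; rw [mk3_eq_iff] at h; rcases h with ⟨h1, h2, h3⟩; linarith [sHalf_pos]

/-- `e₃ ≠ e₃+e₁`. [cite: KreutzZiereis2026, Appendix A.1 p. 35] -/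
theorem ne13 : p1 ≠ p3 := by
  rw [p1, p3]; intro h; rw [mk3_eq_iff] at h; rcases h with ⟨h1, h2, h3⟩; linarith [sHalf_pos]

/-- `e₃ ≠ e₃−e₁`. [cite: KreutzZiereis2026, Appendix A.1 p. 35] -/
theorem ne14 : p1 ≠ p4 := by
  rw [p1, p4]; intro h; rw [mk3_eq_iff] at h; rcases h with ⟨h1, h2, h3⟩; linarith [sHalf_pos]

/-- `e₃ ≠ Re₁`. [cite: KreutzZiereis2026, Appendix A.1 p. 35] -/
theorem ne15 : p1 ≠ p5 := by
  rw [p1, p5]; intro h; rw [mk3_eq_iff] at h; rcases h with ⟨h1, h2, h3⟩; linarith [sHalf_pos]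

/-- `e₃ ≠ −Re₁`. [cite: KreutzZiereis2026, Appendix A.1 p. 35] -/
theorem ne16 : p1 ≠ p6 := by
  rw [p1, p6]; intro h; rw [mk3_eq_iff] at h; rcases h with ⟨h1, h2, h3⟩; linarith [sHalf_pos]

/-- `2e₃ ≠ e₃+e₁`. [cite: KreutzZiereis2026, Appendix A.1 p. 35] -/
theorem ne23 : p2 ≠ p3 := by
  rw [p2, p3]; intro h; rw [mk3_eq_iff] at h; rcases h with ⟨h1, h2, h3⟩; linarith [sHalf_pos]

/-- `2e₃ ≠ e₃−e₁`. [cite: KreutzZiereis2026, Appendix A.1 p. 35] -/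
theorem ne24 : p2 ≠ p4 := by
  rw [p2, p4]; intro h; rw [mk3_eq_iff] at h; rcases h with ⟨h1, h2, h3⟩; linarith [sHalf_pos]

/-- `2e₃ ≠ Re₁`. [cite: KreutzZiereis2026, Appendix A.1 p. 35] -/
theorem ne25 : p2 ≠ p5 := by
  rw [p2, p5]; intro h; rw [mk3_eq_iff] at h; rcases h with ⟨h1, h2, h3⟩; linarith [sHalf_pos]

/-- `2e₃ ≠ −Re₁`. [cite: KreutzZiereis2026, Appendix A.1 p. 35] -/
theorem ne26 : p2 ≠ p6 := by
  rw [p2, p6]; intro h; rw [mk3_eq_iff] at h; rcases h with ⟨h1, h2, h3⟩; linarith [sHalf_pos]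

/-- `e₃+e₁ ≠ e₃−e₁`. [cite: KreutzZiereis2026, Appendix A.1 p. 35] -/
theorem ne34 : p3 ≠ p4 := by
  rw [p3, p4]; intro h; rw [mk3_eq_iff] at h; rcases h with ⟨h1, h2, h3⟩; linarith [sHalf_pos]

/-- `e₃+e₁ ≠ Re₁`. [cite: KreutzZiereis2026, Appendix A.1 p. 35] -/
theorem ne35 : p3 ≠ p5 := by
  rw [p3, p5]; intro h; rw [mk3_eq_iff] at h; rcases h with ⟨h1, h2, h3⟩; linarith [sHalf_pos]

/-- `e₃+e₁ ≠ −Re₁`. [cite: KreutzZiereis2026, Appendix A.1 p. 35] -/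
theorem ne36 : p3 ≠ p6 := by
  rw [p3, p6]; intro h; rw [mk3_eq_iff] at h; rcases h with ⟨h1, h2, h3⟩; linarith [sHalf_pos]

/-- `e₃−e₁ ≠ Re₁`. [cite: KreutzZiereis2026, Appendix A.1 p. 35] -/
theorem ne45 : p4 ≠ p5 := by
  rw [p4, p5]; intro h; rw [mk3_eq_iff] at h; rcases h with ⟨h1, h2, h3⟩; linarith [sHalf_pos]

/-- `e₃−e₁ ≠ −Re₁`. [cite: KreutzZiereis2026, Appendix A.1 p. 35] -/
theorem ne46 : p4 ≠ p6 := by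
  rw [p4, p6]; intro h; rw [mk3_eq_iff] at h; rcases h with ⟨h1, h2, h3⟩; linarith [sHalf_pos]

/-- `Re₁ ≠ −Re₁`. [cite: KreutzZiereis2026, Appendix A.1 p. 35] -/
theorem ne56 : p5 ≠ p6 := by
  rw [p5, p6]; intro h; rw [mk3_eq_iff] at h; rcases h with ⟨h1, h2, h3⟩; linarith [sHalf_pos]

end Distinctness

/-- Hard core at `0` in `sevenPoints`. [cite: KreutzZiereis2026, Appendix A.1 p. 35] -/
theorem hc_sevenPoints_p0 : ∀ y ∈ sevenPoints, y ≠ p0 → 1 ≤ dist p0 y := by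
  intro y hy hne
  simp only [sevenPoints, Set.mem_insert_iff, Set.mem_singleton_iff] at hy
  rcases hy with rfl | rfl | rfl | rfl | rfl | rfl | rfl
  · exact (hne rfl).elim
  · exact d01.2
  · exact d02.le
  · exact d03.le
  · exact d04.le
  · exact d05.2
  · exact d06.2

/-- `𝒩(0)` in `sevenPoints`. [cite: KreutzZiereis2026, Appendix A.1 p. 35] -/
theorem nbhd_sevenPoints_p0 : nbhd 1 1 sevenPoints p0 = {p1, p5, p6} := by
  ext y
  simp only [nbhd, sevenPoints, Set.mem_setOf_eq, Set.mem_insert_iff, Set.mem_singleton_iff, one_mul]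
  constructor
  · rintro ⟨h, hne, hd⟩
    rcases h with rfl | rfl | rfl | rfl | rfl | rfl | rfl
    · exact (hne rfl).elim
    · simp
    · exact absurd hd (not_le.2 d02)
    · exact absurd hd (not_le.2 d03)
    · exact absurd hd (not_le.2 d04)
    · simp
    · simp
  · rintro (rfl | rfl | rfl)
    · exact ⟨by simp, ne01.symm, d01.1⟩
    · exact ⟨by simp, ne05.symm, d05.1⟩
    · exact ⟨by simp, ne06.symm, d06.1⟩

/-- Hard core at `e₃` in `sevenPoints`. [cite: KreutzZiereis2026, Appendix A.1 p. 35] -/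
theorem hc_sevenPoints_p1 : ∀ y ∈ sevenPoints, y ≠ p1 → 1 ≤ dist p1 y := by
  intro y hy hne
  simp only [sevenPoints, Set.mem_insert_iff, Set.mem_singleton_iff] at hy
  rcases hy with rfl | rfl | rfl | rfl | rfl | rfl | rfl
  · rw [dist_comm]; exact d01.2
  · exact (hne rfl).elim
  · exact d12.2
  · exact d13.2
  · exact d14.2
  · exact d15.le
  · exact d16.le

/-- `𝒩(e₃)` in `sevenPoints`. [cite: KreutzZiereis2026, Appendix A.1 p. 35] -/
theorem nbhd_sevenPoints_p1 : nbhd 1 1 sevenPoints p1 = {p0, p2, p3, p4} := by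
  ext y
  simp only [nbhd, sevenPoints, Set.mem_setOf_eq, Set.mem_insert_iff, Set.mem_singleton_iff, one_mul]
  constructor
  · rintro ⟨h, hne, hd⟩
    rcases h with rfl | rfl | rfl | rfl | rfl | rfl | rfl
    · simp
    · exact (hne rfl).elim
    · simp
    · simp
    · simp
    · exact absurd hd (not_le.2 d15)
    · exact absurd hd (not_le.2 d16)
  · rintro (rfl | rfl | rfl | rfl)
    · exact ⟨by simp, ne01, (by rw [dist_comm]; exact d01.1)⟩
    · exact ⟨by simp, ne12.symm, d12.1⟩
    · exact ⟨by simp, ne13.symm, d13.1⟩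
    · exact ⟨by simp, ne14.symm, d14.1⟩

/-- Hard core at `2e₃` in `sevenPoints`. [cite: KreutzZiereis2026, Appendix A.1 p. 35] -/
theorem hc_sevenPoints_p2 : ∀ y ∈ sevenPoints, y ≠ p2 → 1 ≤ dist p2 y := by
  intro y hy hne
  simp only [sevenPoints, Set.mem_insert_iff, Set.mem_singleton_iff] at hy
  rcases hy with rfl | rfl | rfl | rfl | rfl | rfl | rfl
  · rw [dist_comm]; exact d02.le
  · rw [dist_comm]; exact d12.2
  · exact (hne rfl).elim
  · exact d23.le
  · exact d24.le
  · exact d25.le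
  · exact d26.le

/-- `𝒩(2e₃)` in `sevenPoints`. [cite: KreutzZiereis2026, Appendix A.1 p. 35] -/
theorem nbhd_sevenPoints_p2 : nbhd 1 1 sevenPoints p2 = {p1} := by
  ext y
  simp only [nbhd, sevenPoints, Set.mem_setOf_eq, Set.mem_insert_iff, Set.mem_singleton_iff, one_mul]
  constructor
  · rintro ⟨h, hne, hd⟩
    rcases h with rfl | rfl | rfl | rfl | rfl | rfl | rfl
    · exact absurd hd (not_le.2 (by rw [dist_comm]; exact d02))
    · simp
    · exact (hne rfl).elim
    · exact absurd hd (not_le.2 d23)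
    · exact absurd hd (not_le.2 d24)
    · exact absurd hd (not_le.2 d25)
    · exact absurd hd (not_le.2 d26)
  · rintro rfl
    exact ⟨by simp, ne12, (by rw [dist_comm]; exact d12.1)⟩

/-- Hard core at `e₃+e₁` in `sevenPoints`. [cite: KreutzZiereis2026, Appendix A.1 p. 35] -/
theorem hc_sevenPoints_p3 : ∀ y ∈ sevenPoints, y ≠ p3 → 1 ≤ dist p3 y := by
  intro y hy hne
  simp only [sevenPoints, Set.mem_insert_iff, Set.mem_singleton_iff] at hy
  rcases hy with rfl | rfl | rfl | rfl | rfl | rfl | rfl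
  · rw [dist_comm]; exact d03.le
  · rw [dist_comm]; exact d13.2
  · rw [dist_comm]; exact d23.le
  · exact (hne rfl).elim
  · exact d34.le
  · exact d35.le
  · exact d36.le

/-- `𝒩(e₃+e₁)` in `sevenPoints`. [cite: KreutzZiereis2026, Appendix A.1 p. 35] -/
theorem nbhd_sevenPoints_p3 : nbhd 1 1 sevenPoints p3 = {p1} := by
  ext y
  simp only [nbhd, sevenPoints, Set.mem_setOf_eq, Set.mem_insert_iff, Set.mem_singleton_iff, one_mul]
  constructor
  · rintro ⟨h, hne, hd⟩
    rcases h with rfl | rfl | rfl | rfl | rfl | rfl | rfl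
    · exact absurd hd (not_le.2 (by rw [dist_comm]; exact d03))
    · simp
    · exact absurd hd (not_le.2 (by rw [dist_comm]; exact d23))
    · exact (hne rfl).elim
    · exact absurd hd (not_le.2 d34)
    · exact absurd hd (not_le.2 d35)
    · exact absurd hd (not_le.2 d36)
  · rintro rfl
    exact ⟨by simp, ne13, (by rw [dist_comm]; exact d13.1)⟩

/-- Hard core at `e₃−e₁` in `sevenPoints`. [cite: KreutzZiereis2026, Appendix A.1 p. 35] -/
theorem hc_sevenPoints_p4 : ∀ y ∈ sevenPoints, y ≠ p4 → 1 ≤ dist p4 y := by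
  intro y hy hne
  simp only [sevenPoints, Set.mem_insert_iff, Set.mem_singleton_iff] at hy
  rcases hy with rfl | rfl | rfl | rfl | rfl | rfl | rfl
  · rw [dist_comm]; exact d04.le
  · rw [dist_comm]; exact d14.2
  · rw [dist_comm]; exact d24.le
  · rw [dist_comm]; exact d34.le
  · exact (hne rfl).elim
  · exact d45.le
  · exact d46.le

/-- `𝒩(e₃−e₁)` in `sevenPoints`. [cite: KreutzZiereis2026, Appendix A.1 p. 35] -/
theorem nbhd_sevenPoints_p4 : nbhd 1 1 sevenPoints p4 = {p1} := by
  ext y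
  simp only [nbhd, sevenPoints, Set.mem_setOf_eq, Set.mem_insert_iff, Set.mem_singleton_iff, one_mul]
  constructor
  · rintro ⟨h, hne, hd⟩
    rcases h with rfl | rfl | rfl | rfl | rfl | rfl | rfl
    · exact absurd hd (not_le.2 (by rw [dist_comm]; exact d04))
    · simp
    · exact absurd hd (not_le.2 (by rw [dist_comm]; exact d24))
    · exact absurd hd (not_le.2 (by rw [dist_comm]; exact d34))
    · exact (hne rfl).elim
    · exact absurd hd (not_le.2 d45)
    · exact absurd hd (not_le.2 d46)
  · rintro rfl
    exact ⟨by simp, ne14, (by rw [dist_comm]; exact d14.1)⟩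

/-- Hard core at `Re₁` in `sevenPoints`. [cite: KreutzZiereis2026, Appendix A.1 p. 35] -/
theorem hc_sevenPoints_p5 : ∀ y ∈ sevenPoints, y ≠ p5 → 1 ≤ dist p5 y := by
  intro y hy hne
  simp only [sevenPoints, Set.mem_insert_iff, Set.mem_singleton_iff] at hy
  rcases hy with rfl | rfl | rfl | rfl | rfl | rfl | rfl
  · rw [dist_comm]; exact d05.2
  · rw [dist_comm]; exact d15.le
  · rw [dist_comm]; exact d25.le
  · rw [dist_comm]; exact d35.le
  · rw [dist_comm]; exact d45.le
  · exact (hne rfl).elim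
  · exact d56.le

/-- `𝒩(Re₁)` in `sevenPoints`. [cite: KreutzZiereis2026, Appendix A.1 p. 35] -/
theorem nbhd_sevenPoints_p5 : nbhd 1 1 sevenPoints p5 = {p0} := by
  ext y
  simp only [nbhd, sevenPoints, Set.mem_setOf_eq, Set.mem_insert_iff, Set.mem_singleton_iff, one_mul]
  constructor
  · rintro ⟨h, hne, hd⟩
    rcases h with rfl | rfl | rfl | rfl | rfl | rfl | rfl
    · simp
    · exact absurd hd (not_le.2 (by rw [dist_comm]; exact d15))
    · exact absurd hd (not_le.2 (by rw [dist_comm]; exact d25))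
    · exact absurd hd (not_le.2 (by rw [dist_comm]; exact d35))
    · exact absurd hd (not_le.2 (by rw [dist_comm]; exact d45))
    · exact (hne rfl).elim
    · exact absurd hd (not_le.2 d56)
  · rintro rfl
    exact ⟨by simp, ne05, (by rw [dist_comm]; exact d05.1)⟩

/-- Hard core at `−Re₁` in `sevenPoints`. [cite: KreutzZiereis2026, Appendix A.1 p. 35] -/
theorem hc_sevenPoints_p6 : ∀ y ∈ sevenPoints, y ≠ p6 → 1 ≤ dist p6 y := by
  intro y hy hne
  simp only [sevenPoints, Set.mem_insert_iff, Set.mem_singleton_iff] at hy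
  rcases hy with rfl | rfl | rfl | rfl | rfl | rfl | rfl
  · rw [dist_comm]; exact d06.2
  · rw [dist_comm]; exact d16.le
  · rw [dist_comm]; exact d26.le
  · rw [dist_comm]; exact d36.le
  · rw [dist_comm]; exact d46.le
  · rw [dist_comm]; exact d56.le
  · exact (hne rfl).elim

/-- `𝒩(−Re₁)` in `sevenPoints`. [cite: KreutzZiereis2026, Appendix A.1 p. 35] -/
theorem nbhd_sevenPoints_p6 : nbhd 1 1 sevenPoints p6 = {p0} := by
  ext y
  simp only [nbhd, sevenPoints, Set.mem_setOf_eq, Set.mem_insert_iff, Set.mem_singleton_iff, one_mul]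
  constructor
  · rintro ⟨h, hne, hd⟩
    rcases h with rfl | rfl | rfl | rfl | rfl | rfl | rfl
    · simp
    · exact absurd hd (not_le.2 (by rw [dist_comm]; exact d16))
    · exact absurd hd (not_le.2 (by rw [dist_comm]; exact d26))
    · exact absurd hd (not_le.2 (by rw [dist_comm]; exact d36))
    · exact absurd hd (not_le.2 (by rw [dist_comm]; exact d46))
    · exact absurd hd (not_le.2 (by rw [dist_comm]; exact d56))
    · exact (hne rfl).elim
  · rintro rfl
    exact ⟨by simp, ne06, (by rw [dist_comm]; exact d06.1)⟩

/-- Hard core at `0` in `sixPoints`. [cite: KreutzZiereis2026, Appendix A.1 p. 35] -/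
theorem hc_sixPoints_p0 : ∀ y ∈ sixPoints, y ≠ p0 → 1 ≤ dist p0 y := by
  intro y hy hne
  simp only [sixPoints, Set.mem_insert_iff, Set.mem_singleton_iff] at hy
  rcases hy with rfl | rfl | rfl | rfl | rfl | rfl
  · exact (hne rfl).elim
  · exact d02.le
  · exact d03.le
  · exact d04.le
  · exact d05.2
  · exact d06.2

/-- `𝒩(0)` in `sixPoints`. [cite: KreutzZiereis2026, Appendix A.1 p. 35] -/
theorem nbhd_sixPoints_p0 : nbhd 1 1 sixPoints p0 = {p5, p6} := by
  ext y
  simp only [nbhd, sixPoints, Set.mem_setOf_eq, Set.mem_insert_iff, Set.mem_singleton_iff, one_mul]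
  constructor
  · rintro ⟨h, hne, hd⟩
    rcases h with rfl | rfl | rfl | rfl | rfl | rfl
    · exact (hne rfl).elim
    · exact absurd hd (not_le.2 d02)
    · exact absurd hd (not_le.2 d03)
    · exact absurd hd (not_le.2 d04)
    · simp
    · simp
  · rintro (rfl | rfl)
    · exact ⟨by simp, ne05.symm, d05.1⟩
    · exact ⟨by simp, ne06.symm, d06.1⟩

/-- Hard core at `2e₃` in `sixPoints`. [cite: KreutzZiereis2026, Appendix A.1 p. 35] -/
theorem hc_sixPoints_p2 : ∀ y ∈ sixPoints, y ≠ p2 → 1 ≤ dist p2 y := by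
  intro y hy hne
  simp only [sixPoints, Set.mem_insert_iff, Set.mem_singleton_iff] at hy
  rcases hy with rfl | rfl | rfl | rfl | rfl | rfl
  · rw [dist_comm]; exact d02.le
  · exact (hne rfl).elim
  · exact d23.le
  · exact d24.le
  · exact d25.le
  · exact d26.le

/-- `𝒩(2e₃) = ∅` in `sixPoints`. [cite: KreutzZiereis2026, Appendix A.1 p. 35] -/
theorem nbhd_sixPoints_p2 : nbhd 1 1 sixPoints p2 = ∅ := by
  ext y
  simp only [nbhd, sixPoints, Set.mem_setOf_eq, Set.mem_insert_iff, Set.mem_singleton_iff, one_mul,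
    Set.mem_empty_iff_false, iff_false, not_and, not_le]
  intro h hne
  rcases h with rfl | rfl | rfl | rfl | rfl | rfl
  · rw [dist_comm]; exact d02
  · exact (hne rfl).elim
  · exact d23
  · exact d24
  · exact d25
  · exact d26

/-- Hard core at `e₃+e₁` in `sixPoints`. [cite: KreutzZiereis2026, Appendix A.1 p. 35] -/
theorem hc_sixPoints_p3 : ∀ y ∈ sixPoints, y ≠ p3 → 1 ≤ dist p3 y := by
  intro y hy hne
  simp only [sixPoints, Set.mem_insert_iff, Set.mem_singleton_iff] at hy
  rcases hy with rfl | rfl | rfl | rfl | rfl | rfl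
  · rw [dist_comm]; exact d03.le
  · rw [dist_comm]; exact d23.le
  · exact (hne rfl).elim
  · exact d34.le
  · exact d35.le
  · exact d36.le

/-- `𝒩(e₃+e₁) = ∅` in `sixPoints`. [cite: KreutzZiereis2026, Appendix A.1 p. 35] -/
theorem nbhd_sixPoints_p3 : nbhd 1 1 sixPoints p3 = ∅ := by
  ext y
  simp only [nbhd, sixPoints, Set.mem_setOf_eq, Set.mem_insert_iff, Set.mem_singleton_iff, one_mul,
    Set.mem_empty_iff_false, iff_false, not_and, not_le]
  intro h hne
  rcases h with rfl | rfl | rfl | rfl | rfl | rfl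
  · rw [dist_comm]; exact d03
  · rw [dist_comm]; exact d23
  · exact (hne rfl).elim
  · exact d34
  · exact d35
  · exact d36

/-- Hard core at `e₃−e₁` in `sixPoints`. [cite: KreutzZiereis2026, Appendix A.1 p. 35] -/
theorem hc_sixPoints_p4 : ∀ y ∈ sixPoints, y ≠ p4 → 1 ≤ dist p4 y := by
  intro y hy hne
  simp only [sixPoints, Set.mem_insert_iff, Set.mem_singleton_iff] at hy
  rcases hy with rfl | rfl | rfl | rfl | rfl | rfl
  · rw [dist_comm]; exact d04.le
  · rw [dist_comm]; exact d24.le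
  · rw [dist_comm]; exact d34.le
  · exact (hne rfl).elim
  · exact d45.le
  · exact d46.le

/-- `𝒩(e₃−e₁) = ∅` in `sixPoints`. [cite: KreutzZiereis2026, Appendix A.1 p. 35] -/
theorem nbhd_sixPoints_p4 : nbhd 1 1 sixPoints p4 = ∅ := by
  ext y
  simp only [nbhd, sixPoints, Set.mem_setOf_eq, Set.mem_insert_iff, Set.mem_singleton_iff, one_mul,
    Set.mem_empty_iff_false, iff_false, not_and, not_le]
  intro h hne
  rcases h with rfl | rfl | rfl | rfl | rfl | rfl
  · rw [dist_comm]; exact d04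
  · rw [dist_comm]; exact d24
  · rw [dist_comm]; exact d34
  · exact (hne rfl).elim
  · exact d45
  · exact d46

/-- Hard core at `Re₁` in `sixPoints`. [cite: KreutzZiereis2026, Appendix A.1 p. 35] -/
theorem hc_sixPoints_p5 : ∀ y ∈ sixPoints, y ≠ p5 → 1 ≤ dist p5 y := by
  intro y hy hne
  simp only [sixPoints, Set.mem_insert_iff, Set.mem_singleton_iff] at hy
  rcases hy with rfl | rfl | rfl | rfl | rfl | rfl
  · rw [dist_comm]; exact d05.2
  · rw [dist_comm]; exact d25.le
  · rw [dist_comm]; exact d35.le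
  · rw [dist_comm]; exact d45.le
  · exact (hne rfl).elim
  · exact d56.le

/-- `𝒩(Re₁)` in `sixPoints`. [cite: KreutzZiereis2026, Appendix A.1 p. 35] -/
theorem nbhd_sixPoints_p5 : nbhd 1 1 sixPoints p5 = {p0} := by
  ext y
  simp only [nbhd, sixPoints, Set.mem_setOf_eq, Set.mem_insert_iff, Set.mem_singleton_iff, one_mul]
  constructor
  · rintro ⟨h, hne, hd⟩
    rcases h with rfl | rfl | rfl | rfl | rfl | rfl
    · simp
    · exact absurd hd (not_le.2 (by rw [dist_comm]; exact d25))
    · exact absurd hd (not_le.2 (by rw [dist_comm]; exact d35))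
    · exact absurd hd (not_le.2 (by rw [dist_comm]; exact d45))
    · exact (hne rfl).elim
    · exact absurd hd (not_le.2 d56)
  · rintro rfl
    exact ⟨by simp, ne05, (by rw [dist_comm]; exact d05.1)⟩

/-- Hard core at `−Re₁` in `sixPoints`. [cite: KreutzZiereis2026, Appendix A.1 p. 35] -/
theorem hc_sixPoints_p6 : ∀ y ∈ sixPoints, y ≠ p6 → 1 ≤ dist p6 y := by
  intro y hy hne
  simp only [sixPoints, Set.mem_insert_iff, Set.mem_singleton_iff] at hy
  rcases hy with rfl | rfl | rfl | rfl | rfl | rfl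
  · rw [dist_comm]; exact d06.2
  · rw [dist_comm]; exact d26.le
  · rw [dist_comm]; exact d36.le
  · rw [dist_comm]; exact d46.le
  · rw [dist_comm]; exact d56.le
  · exact (hne rfl).elim

/-- `𝒩(−Re₁)` in `sixPoints`. [cite: KreutzZiereis2026, Appendix A.1 p. 35] -/
theorem nbhd_sixPoints_p6 : nbhd 1 1 sixPoints p6 = {p0} := by
  ext y
  simp only [nbhd, sixPoints, Set.mem_setOf_eq, Set.mem_insert_iff, Set.mem_singleton_iff, one_mul]
  constructor
  · rintro ⟨h, hne, hd⟩
    rcases h with rfl | rfl | rfl | rfl | rfl | rfl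
    · simp
    · exact absurd hd (not_le.2 (by rw [dist_comm]; exact d26))
    · exact absurd hd (not_le.2 (by rw [dist_comm]; exact d36))
    · exact absurd hd (not_le.2 (by rw [dist_comm]; exact d46))
    · exact absurd hd (not_le.2 (by rw [dist_comm]; exact d56))
    · exact (hne rfl).elim
  · rintro rfl
    exact ⟨by simp, ne06, (by rw [dist_comm]; exact d06.1)⟩

section BadPairs

/-- No charged angle at `0` in `sevenPoints` (all bond angles are multiples of `π/2`). [cite: KreutzZiereis2026, Appendix A.1 p. 35] -/
theorem bad_sevenPoints_p0 : badAnglePairs sevenPoints p0 = ∅ := by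
  rw [badAnglePairs, Set.eq_empty_iff_forall_notMem]
  rintro ⟨y, z⟩ ⟨hy, hz, hne, h0, h1⟩
  rw [nbhd_sevenPoints_p0] at hy hz
  simp only [Set.mem_insert_iff, Set.mem_singleton_iff] at hy hz
  rcases hy with rfl | rfl | rfl <;> rcases hz with rfl | rfl | rfl
  all_goals
    first
    | exact (hne rfl).elim
    | (simp only [p0, p1, p5, p6, mk3_sub, inner_mk3] at h0 h1
       first
       | exact h0 (by nlinarith [sHalf_sq])
       | exact h1 (by nlinarith [sHalf_sq]))

/-- No charged angle at `e₃` in `sevenPoints` (all bond angles are multiples of `π/2`). [cite: KreutzZiereis2026, Appendix A.1 p. 35] -/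
theorem bad_sevenPoints_p1 : badAnglePairs sevenPoints p1 = ∅ := by
  rw [badAnglePairs, Set.eq_empty_iff_forall_notMem]
  rintro ⟨y, z⟩ ⟨hy, hz, hne, h0, h1⟩
  rw [nbhd_sevenPoints_p1] at hy hz
  simp only [Set.mem_insert_iff, Set.mem_singleton_iff] at hy hz
  rcases hy with rfl | rfl | rfl | rfl <;> rcases hz with rfl | rfl | rfl | rfl
  all_goals
    first
    | exact (hne rfl).elim
    | (simp only [p0, p1, p2, p3, p4, mk3_sub, inner_mk3] at h0 h1
       first
       | exact h0 (by nlinarith [sHalf_sq])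
       | exact h1 (by nlinarith [sHalf_sq]))

/-- No charged angle at `2e₃` in `sevenPoints` (all bond angles are multiples of `π/2`). [cite: KreutzZiereis2026, Appendix A.1 p. 35] -/
theorem bad_sevenPoints_p2 : badAnglePairs sevenPoints p2 = ∅ := by
  rw [badAnglePairs, Set.eq_empty_iff_forall_notMem]
  rintro ⟨y, z⟩ ⟨hy, hz, hne, h0, h1⟩
  rw [nbhd_sevenPoints_p2] at hy hz
  rw [Set.mem_singleton_iff] at hy hz
  exact hne (hy.trans hz.symm)

/-- No charged angle at `e₃+e₁` in `sevenPoints` (all bond angles are multiples of `π/2`). [cite: KreutzZiereis2026, Appendix A.1 p. 35] -/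
theorem bad_sevenPoints_p3 : badAnglePairs sevenPoints p3 = ∅ := by
  rw [badAnglePairs, Set.eq_empty_iff_forall_notMem]
  rintro ⟨y, z⟩ ⟨hy, hz, hne, h0, h1⟩
  rw [nbhd_sevenPoints_p3] at hy hz
  rw [Set.mem_singleton_iff] at hy hz
  exact hne (hy.trans hz.symm)

/-- No charged angle at `e₃−e₁` in `sevenPoints` (all bond angles are multiples of `π/2`). [cite: KreutzZiereis2026, Appendix A.1 p. 35] -/
theorem bad_sevenPoints_p4 : badAnglePairs sevenPoints p4 = ∅ := by
  rw [badAnglePairs, Set.eq_empty_iff_forall_notMem]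
  rintro ⟨y, z⟩ ⟨hy, hz, hne, h0, h1⟩
  rw [nbhd_sevenPoints_p4] at hy hz
  rw [Set.mem_singleton_iff] at hy hz
  exact hne (hy.trans hz.symm)

/-- No charged angle at `Re₁` in `sevenPoints` (all bond angles are multiples of `π/2`). [cite: KreutzZiereis2026, Appendix A.1 p. 35] -/
theorem bad_sevenPoints_p5 : badAnglePairs sevenPoints p5 = ∅ := by
  rw [badAnglePairs, Set.eq_empty_iff_forall_notMem]
  rintro ⟨y, z⟩ ⟨hy, hz, hne, h0, h1⟩
  rw [nbhd_sevenPoints_p5] at hy hz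
  rw [Set.mem_singleton_iff] at hy hz
  exact hne (hy.trans hz.symm)

/-- No charged angle at `−Re₁` in `sevenPoints` (all bond angles are multiples of `π/2`). [cite: KreutzZiereis2026, Appendix A.1 p. 35] -/
theorem bad_sevenPoints_p6 : badAnglePairs sevenPoints p6 = ∅ := by
  rw [badAnglePairs, Set.eq_empty_iff_forall_notMem]
  rintro ⟨y, z⟩ ⟨hy, hz, hne, h0, h1⟩
  rw [nbhd_sevenPoints_p6] at hy hz
  rw [Set.mem_singleton_iff] at hy hz
  exact hne (hy.trans hz.symm)

/-- No charged angle at `0` in `sixPoints` (all bond angles are multiples of `π/2`). [cite: KreutzZiereis2026, Appendix A.1 p. 35] -/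
theorem bad_sixPoints_p0 : badAnglePairs sixPoints p0 = ∅ := by
  rw [badAnglePairs, Set.eq_empty_iff_forall_notMem]
  rintro ⟨y, z⟩ ⟨hy, hz, hne, h0, h1⟩
  rw [nbhd_sixPoints_p0] at hy hz
  simp only [Set.mem_insert_iff, Set.mem_singleton_iff] at hy hz
  rcases hy with rfl | rfl <;> rcases hz with rfl | rfl
  all_goals
    first
    | exact (hne rfl).elim
    | (simp only [p0, p5, p6, mk3_sub, inner_mk3] at h0 h1
       first
       | exact h0 (by nlinarith [sHalf_sq])
       | exact h1 (by nlinarith [sHalf_sq]))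

/-- No charged angle at `2e₃` in `sixPoints` (all bond angles are multiples of `π/2`). [cite: KreutzZiereis2026, Appendix A.1 p. 35] -/
theorem bad_sixPoints_p2 : badAnglePairs sixPoints p2 = ∅ := by
  rw [badAnglePairs, Set.eq_empty_iff_forall_notMem]
  rintro ⟨y, z⟩ ⟨hy, hz, hne, h0, h1⟩
  rw [nbhd_sixPoints_p2] at hy hz
  exact hy

/-- No charged angle at `e₃+e₁` in `sixPoints` (all bond angles are multiples of `π/2`). [cite: KreutzZiereis2026, Appendix A.1 p. 35] -/
theorem bad_sixPoints_p3 : badAnglePairs sixPoints p3 = ∅ := by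
  rw [badAnglePairs, Set.eq_empty_iff_forall_notMem]
  rintro ⟨y, z⟩ ⟨hy, hz, hne, h0, h1⟩
  rw [nbhd_sixPoints_p3] at hy hz
  exact hy

/-- No charged angle at `e₃−e₁` in `sixPoints` (all bond angles are multiples of `π/2`). [cite: KreutzZiereis2026, Appendix A.1 p. 35] -/
theorem bad_sixPoints_p4 : badAnglePairs sixPoints p4 = ∅ := by
  rw [badAnglePairs, Set.eq_empty_iff_forall_notMem]
  rintro ⟨y, z⟩ ⟨hy, hz, hne, h0, h1⟩
  rw [nbhd_sixPoints_p4] at hy hz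
  exact hy

/-- No charged angle at `Re₁` in `sixPoints` (all bond angles are multiples of `π/2`). [cite: KreutzZiereis2026, Appendix A.1 p. 35] -/
theorem bad_sixPoints_p5 : badAnglePairs sixPoints p5 = ∅ := by
  rw [badAnglePairs, Set.eq_empty_iff_forall_notMem]
  rintro ⟨y, z⟩ ⟨hy, hz, hne, h0, h1⟩
  rw [nbhd_sixPoints_p5] at hy hz
  rw [Set.mem_singleton_iff] at hy hz
  exact hne (hy.trans hz.symm)

/-- No charged angle at `−Re₁` in `sixPoints` (all bond angles are multiples of `π/2`). [cite: KreutzZiereis2026, Appendix A.1 p. 35] -/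
theorem bad_sixPoints_p6 : badAnglePairs sixPoints p6 = ∅ := by
  rw [badAnglePairs, Set.eq_empty_iff_forall_notMem]
  rintro ⟨y, z⟩ ⟨hy, hz, hne, h0, h1⟩
  rw [nbhd_sixPoints_p6] at hy hz
  rw [Set.mem_singleton_iff] at hy hz
  exact hne (hy.trans hz.symm)

end BadPairs

section Cells

variable (C : ℝ)

/-- `#𝒩(0) = 3` in `sevenPoints`. [cite: KreutzZiereis2026, Appendix A.1 p. 35] -/
theorem ncard_nbhd_sevenPoints_p0 : (nbhd 1 1 sevenPoints p0).ncard = 3 :=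
  by rw [nbhd_sevenPoints_p0]; exact Set.ncard_eq_three.2 ⟨p1, p5, p6, ne15, ne16, ne56, rfl⟩

/-- `E_cell(0, sevenPoints) = ½(6 − 3) = 3 / 2`. [cite: KreutzZiereis2026, Appendix A.1 p. 35] -/
theorem cell_sevenPoints_p0 : stickyAngularCell 3 C p0 sevenPoints = ENNReal.ofReal (3 / 2) := by
  rw [stickyAngularCell_eq hc_sevenPoints_p0 3 (ncard_nbhd_sevenPoints_p0) bad_sevenPoints_p0]
  norm_num

/-- `#𝒩(e₃) = 4` in `sevenPoints`. [cite: KreutzZiereis2026, Appendix A.1 p. 35] -/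
theorem ncard_nbhd_sevenPoints_p1 : (nbhd 1 1 sevenPoints p1).ncard = 4 :=
  by rw [nbhd_sevenPoints_p1, Set.ncard_insert_of_notMem (by simp [ne02, ne03, ne04]) (Set.toFinite _)]; rw [Set.ncard_eq_three.2 ⟨p2, p3, p4, ne23, ne24, ne34, rfl⟩]

/-- `E_cell(e₃, sevenPoints) = ½(6 − 4) = 1`. [cite: KreutzZiereis2026, Appendix A.1 p. 35] -/
theorem cell_sevenPoints_p1 : stickyAngularCell 3 C p1 sevenPoints = ENNReal.ofReal (1) := by
  rw [stickyAngularCell_eq hc_sevenPoints_p1 4 (ncard_nbhd_sevenPoints_p1) bad_sevenPoints_p1]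
  norm_num

/-- `#𝒩(2e₃) = 1` in `sevenPoints`. [cite: KreutzZiereis2026, Appendix A.1 p. 35] -/
theorem ncard_nbhd_sevenPoints_p2 : (nbhd 1 1 sevenPoints p2).ncard = 1 :=
  by rw [nbhd_sevenPoints_p2, Set.ncard_singleton]

/-- `E_cell(2e₃, sevenPoints) = ½(6 − 1) = 5 / 2`. [cite: KreutzZiereis2026, Appendix A.1 p. 35] -/
theorem cell_sevenPoints_p2 : stickyAngularCell 3 C p2 sevenPoints = ENNReal.ofReal (5 / 2) := by
  rw [stickyAngularCell_eq hc_sevenPoints_p2 1 (ncard_nbhd_sevenPoints_p2) bad_sevenPoints_p2]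
  norm_num

/-- `#𝒩(e₃+e₁) = 1` in `sevenPoints`. [cite: KreutzZiereis2026, Appendix A.1 p. 35] -/
theorem ncard_nbhd_sevenPoints_p3 : (nbhd 1 1 sevenPoints p3).ncard = 1 :=
  by rw [nbhd_sevenPoints_p3, Set.ncard_singleton]

/-- `E_cell(e₃+e₁, sevenPoints) = ½(6 − 1) = 5 / 2`. [cite: KreutzZiereis2026, Appendix A.1 p. 35] -/
theorem cell_sevenPoints_p3 : stickyAngularCell 3 C p3 sevenPoints = ENNReal.ofReal (5 / 2) := by
  rw [stickyAngularCell_eq hc_sevenPoints_p3 1 (ncard_nbhd_sevenPoints_p3) bad_sevenPoints_p3]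
  norm_num

/-- `#𝒩(e₃−e₁) = 1` in `sevenPoints`. [cite: KreutzZiereis2026, Appendix A.1 p. 35] -/
theorem ncard_nbhd_sevenPoints_p4 : (nbhd 1 1 sevenPoints p4).ncard = 1 :=
  by rw [nbhd_sevenPoints_p4, Set.ncard_singleton]

/-- `E_cell(e₃−e₁, sevenPoints) = ½(6 − 1) = 5 / 2`. [cite: KreutzZiereis2026, Appendix A.1 p. 35] -/
theorem cell_sevenPoints_p4 : stickyAngularCell 3 C p4 sevenPoints = ENNReal.ofReal (5 / 2) := by
  rw [stickyAngularCell_eq hc_sevenPoints_p4 1 (ncard_nbhd_sevenPoints_p4) bad_sevenPoints_p4]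
  norm_num

/-- `#𝒩(Re₁) = 1` in `sevenPoints`. [cite: KreutzZiereis2026, Appendix A.1 p. 35] -/
theorem ncard_nbhd_sevenPoints_p5 : (nbhd 1 1 sevenPoints p5).ncard = 1 :=
  by rw [nbhd_sevenPoints_p5, Set.ncard_singleton]

/-- `E_cell(Re₁, sevenPoints) = ½(6 − 1) = 5 / 2`. [cite: KreutzZiereis2026, Appendix A.1 p. 35] -/
theorem cell_sevenPoints_p5 : stickyAngularCell 3 C p5 sevenPoints = ENNReal.ofReal (5 / 2) := by
  rw [stickyAngularCell_eq hc_sevenPoints_p5 1 (ncard_nbhd_sevenPoints_p5) bad_sevenPoints_p5]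
  norm_num

/-- `#𝒩(−Re₁) = 1` in `sevenPoints`. [cite: KreutzZiereis2026, Appendix A.1 p. 35] -/
theorem ncard_nbhd_sevenPoints_p6 : (nbhd 1 1 sevenPoints p6).ncard = 1 :=
  by rw [nbhd_sevenPoints_p6, Set.ncard_singleton]

/-- `E_cell(−Re₁, sevenPoints) = ½(6 − 1) = 5 / 2`. [cite: KreutzZiereis2026, Appendix A.1 p. 35] -/
theorem cell_sevenPoints_p6 : stickyAngularCell 3 C p6 sevenPoints = ENNReal.ofReal (5 / 2) := by
  rw [stickyAngularCell_eq hc_sevenPoints_p6 1 (ncard_nbhd_sevenPoints_p6) bad_sevenPoints_p6]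
  norm_num

/-- `#𝒩(0) = 2` in `sixPoints`. [cite: KreutzZiereis2026, Appendix A.1 p. 35] -/
theorem ncard_nbhd_sixPoints_p0 : (nbhd 1 1 sixPoints p0).ncard = 2 :=
  by rw [nbhd_sixPoints_p0, Set.ncard_pair ne56]

/-- `E_cell(0, sixPoints) = ½(6 − 2) = 2`. [cite: KreutzZiereis2026, Appendix A.1 p. 35] -/
theorem cell_sixPoints_p0 : stickyAngularCell 3 C p0 sixPoints = ENNReal.ofReal (2) := by
  rw [stickyAngularCell_eq hc_sixPoints_p0 2 (ncard_nbhd_sixPoints_p0) bad_sixPoints_p0]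
  norm_num

/-- `#𝒩(2e₃) = 0` in `sixPoints`. [cite: KreutzZiereis2026, Appendix A.1 p. 35] -/
theorem ncard_nbhd_sixPoints_p2 : (nbhd 1 1 sixPoints p2).ncard = 0 :=
  by rw [nbhd_sixPoints_p2, Set.ncard_empty]

/-- `E_cell(2e₃, sixPoints) = ½(6 − 0) = 3`. [cite: KreutzZiereis2026, Appendix A.1 p. 35] -/
theorem cell_sixPoints_p2 : stickyAngularCell 3 C p2 sixPoints = ENNReal.ofReal (3) := by
  rw [stickyAngularCell_eq hc_sixPoints_p2 0 (ncard_nbhd_sixPoints_p2) bad_sixPoints_p2]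
  norm_num

/-- `#𝒩(e₃+e₁) = 0` in `sixPoints`. [cite: KreutzZiereis2026, Appendix A.1 p. 35] -/
theorem ncard_nbhd_sixPoints_p3 : (nbhd 1 1 sixPoints p3).ncard = 0 :=
  by rw [nbhd_sixPoints_p3, Set.ncard_empty]

/-- `E_cell(e₃+e₁, sixPoints) = ½(6 − 0) = 3`. [cite: KreutzZiereis2026, Appendix A.1 p. 35] -/
theorem cell_sixPoints_p3 : stickyAngularCell 3 C p3 sixPoints = ENNReal.ofReal (3) := by
  rw [stickyAngularCell_eq hc_sixPoints_p3 0 (ncard_nbhd_sixPoints_p3) bad_sixPoints_p3]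
  norm_num

/-- `#𝒩(e₃−e₁) = 0` in `sixPoints`. [cite: KreutzZiereis2026, Appendix A.1 p. 35] -/
theorem ncard_nbhd_sixPoints_p4 : (nbhd 1 1 sixPoints p4).ncard = 0 :=
  by rw [nbhd_sixPoints_p4, Set.ncard_empty]

/-- `E_cell(e₃−e₁, sixPoints) = ½(6 − 0) = 3`. [cite: KreutzZiereis2026, Appendix A.1 p. 35] -/
theorem cell_sixPoints_p4 : stickyAngularCell 3 C p4 sixPoints = ENNReal.ofReal (3) := by
  rw [stickyAngularCell_eq hc_sixPoints_p4 0 (ncard_nbhd_sixPoints_p4) bad_sixPoints_p4]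
  norm_num

/-- `#𝒩(Re₁) = 1` in `sixPoints`. [cite: KreutzZiereis2026, Appendix A.1 p. 35] -/
theorem ncard_nbhd_sixPoints_p5 : (nbhd 1 1 sixPoints p5).ncard = 1 :=
  by rw [nbhd_sixPoints_p5, Set.ncard_singleton]

/-- `E_cell(Re₁, sixPoints) = ½(6 − 1) = 5 / 2`. [cite: KreutzZiereis2026, Appendix A.1 p. 35] -/
theorem cell_sixPoints_p5 : stickyAngularCell 3 C p5 sixPoints = ENNReal.ofReal (5 / 2) := by
  rw [stickyAngularCell_eq hc_sixPoints_p5 1 (ncard_nbhd_sixPoints_p5) bad_sixPoints_p5]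
  norm_num

/-- `#𝒩(−Re₁) = 1` in `sixPoints`. [cite: KreutzZiereis2026, Appendix A.1 p. 35] -/
theorem ncard_nbhd_sixPoints_p6 : (nbhd 1 1 sixPoints p6).ncard = 1 :=
  by rw [nbhd_sixPoints_p6, Set.ncard_singleton]

/-- `E_cell(−Re₁, sixPoints) = ½(6 − 1) = 5 / 2`. [cite: KreutzZiereis2026, Appendix A.1 p. 35] -/
theorem cell_sixPoints_p6 : stickyAngularCell 3 C p6 sixPoints = ENNReal.ofReal (5 / 2) := by
  rw [stickyAngularCell_eq hc_sixPoints_p6 1 (ncard_nbhd_sixPoints_p6) bad_sixPoints_p6]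
  norm_num

/-- `E₁(sevenPoints) = 15`. [cite: KreutzZiereis2026, Appendix A.1 p. 35] -/
theorem energy_sevenPoints : energy (stickyAngularCell 3 C) 1 sevenPoints univ = ENNReal.ofReal 15 := by
  rw [energy_one_univ]
  show ∑ᶠ x ∈ ({p0, p1, p2, p3, p4, p5, p6} : Set (EuclideanSpace ℝ (Fin 3))), stickyAngularCell 3 C x sevenPoints = _
  rw [finsum_mem_insert _ (by simp [ne01, ne02, ne03, ne04, ne05, ne06] : p0 ∉ ({p1, p2, p3, p4, p5, p6} : Set (EuclideanSpace ℝ (Fin 3)))) (Set.toFinite _),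
    finsum_mem_insert _ (by simp [ne12, ne13, ne14, ne15, ne16] : p1 ∉ ({p2, p3, p4, p5, p6} : Set (EuclideanSpace ℝ (Fin 3)))) (Set.toFinite _),
    finsum_mem_insert _ (by simp [ne23, ne24, ne25, ne26] : p2 ∉ ({p3, p4, p5, p6} : Set (EuclideanSpace ℝ (Fin 3)))) (Set.toFinite _),
    finsum_mem_insert _ (by simp [ne34, ne35, ne36] : p3 ∉ ({p4, p5, p6} : Set (EuclideanSpace ℝ (Fin 3)))) (Set.toFinite _),
    finsum_mem_insert _ (by simp [ne45, ne46] : p4 ∉ ({p5, p6} : Set (EuclideanSpace ℝ (Fin 3)))) (Set.toFinite _),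
    finsum_mem_insert _ (by simp [ne56] : p5 ∉ ({p6} : Set (EuclideanSpace ℝ (Fin 3)))) (Set.toFinite _),
    finsum_mem_singleton]
  rw [cell_sevenPoints_p0, cell_sevenPoints_p1, cell_sevenPoints_p2, cell_sevenPoints_p3, cell_sevenPoints_p4, cell_sevenPoints_p5, cell_sevenPoints_p6]
  rw [← ENNReal.ofReal_add, ← ENNReal.ofReal_add, ← ENNReal.ofReal_add, ← ENNReal.ofReal_add, ← ENNReal.ofReal_add, ← ENNReal.ofReal_add]
  · norm_num
  all_goals norm_num

/-- `E₁(sixPoints) = 16`. [cite: KreutzZiereis2026, Appendix A.1 p. 35] -/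
theorem energy_sixPoints : energy (stickyAngularCell 3 C) 1 sixPoints univ = ENNReal.ofReal 16 := by
  rw [energy_one_univ]
  show ∑ᶠ x ∈ ({p0, p2, p3, p4, p5, p6} : Set (EuclideanSpace ℝ (Fin 3))), stickyAngularCell 3 C x sixPoints = _
  rw [finsum_mem_insert _ (by simp [ne02, ne03, ne04, ne05, ne06] : p0 ∉ ({p2, p3, p4, p5, p6} : Set (EuclideanSpace ℝ (Fin 3)))) (Set.toFinite _),
    finsum_mem_insert _ (by simp [ne23, ne24, ne25, ne26] : p2 ∉ ({p3, p4, p5, p6} : Set (EuclideanSpace ℝ (Fin 3)))) (Set.toFinite _),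
    finsum_mem_insert _ (by simp [ne34, ne35, ne36] : p3 ∉ ({p4, p5, p6} : Set (EuclideanSpace ℝ (Fin 3)))) (Set.toFinite _),
    finsum_mem_insert _ (by simp [ne45, ne46] : p4 ∉ ({p5, p6} : Set (EuclideanSpace ℝ (Fin 3)))) (Set.toFinite _),
    finsum_mem_insert _ (by simp [ne56] : p5 ∉ ({p6} : Set (EuclideanSpace ℝ (Fin 3)))) (Set.toFinite _),
    finsum_mem_singleton]
  rw [cell_sixPoints_p0, cell_sixPoints_p2, cell_sixPoints_p3, cell_sixPoints_p4, cell_sixPoints_p5, cell_sixPoints_p6]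
  rw [← ENNReal.ofReal_add, ← ENNReal.ofReal_add, ← ENNReal.ofReal_add, ← ENNReal.ofReal_add, ← ENNReal.ofReal_add]
  · norm_num
  all_goals norm_num

end Cells


section Assembly

/-- `X ∖ {e₃} = {0, 2e₃, e₃ ± e₁, ±Re₁}`. [cite: KreutzZiereis2026, Appendix A.1 p. 35] -/
theorem sevenPoints_diff : sevenPoints \ {p1} = sixPoints := by
  ext y
  simp only [sevenPoints, sixPoints, Set.mem_sdiff, Set.mem_insert_iff, Set.mem_singleton_iff]
  constructor
  · rintro ⟨h, hne⟩
    rcases h with rfl | rfl | rfl | rfl | rfl | rfl | rfl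
    · simp
    · exact (hne rfl).elim
    · simp
    · simp
    · simp
    · simp
    · simp
  · rintro (rfl | rfl | rfl | rfl | rfl | rfl)
    · exact ⟨by simp, ne01⟩
    · exact ⟨by simp, ne12.symm⟩
    · exact ⟨by simp, ne13.symm⟩
    · exact ⟨by simp, ne14.symm⟩
    · exact ⟨by simp, ne15.symm⟩
    · exact ⟨by simp, ne16.symm⟩

/-- The seven-point configuration is finite. [cite: KreutzZiereis2026, Appendix A.1 p. 35] -/
theorem sevenPoints_finite : sevenPoints.Finite := by
  unfold sevenPoints; exact Set.toFinite _

/-- The rotation `R` by `π/4` about the `x₃`-axis, as a linear automorphism of `ℝ³`.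
[cite: KreutzZiereis2026, Appendix A.1 p. 35] -/
def rotQuarterLin : EuclideanSpace ℝ (Fin 3) ≃ₗ[ℝ] EuclideanSpace ℝ (Fin 3) where
  toFun p := mk3 (sHalf * (p 0 - p 1)) (sHalf * (p 0 + p 1)) (p 2)
  invFun p := mk3 (sHalf * (p 0 + p 1)) (sHalf * (p 1 - p 0)) (p 2)
  map_add' p q := by
    ext i; fin_cases i <;> simp [mk3] <;> ring
  map_smul' c p := by
    ext i; fin_cases i <;> simp [mk3] <;> ring
  left_inv p := by
    have h := two_mul_sHalf_sq
    ext i; fin_cases i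
    · simp [mk3]; linear_combination (p 0) * h
    · simp [mk3]; linear_combination (p 1) * h
    · simp [mk3]
  right_inv p := by
    have h := two_mul_sHalf_sq
    ext i; fin_cases i
    · simp [mk3]; linear_combination (p 0) * h
    · simp [mk3]; linear_combination (p 1) * h
    · simp [mk3]

/-- `R` on coordinates. [cite: KreutzZiereis2026, Appendix A.1 p. 35] -/
theorem rotQuarterLin_mk3 (a b c : ℝ) :
    rotQuarterLin (mk3 a b c) = mk3 (sHalf * (a - b)) (sHalf * (a + b)) c := rfl

/-- `R` preserves the inner product. [cite: KreutzZiereis2026, Appendix A.1 p. 35] -/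
theorem inner_rotQuarterLin (p q : EuclideanSpace ℝ (Fin 3)) :
    ⟪rotQuarterLin p, rotQuarterLin q⟫_ℝ = ⟪p, q⟫_ℝ := by
  have hp : p = mk3 (p 0) (p 1) (p 2) := by ext i; fin_cases i <;> rfl
  have hq : q = mk3 (q 0) (q 1) (q 2) := by ext i; fin_cases i <;> rfl
  rw [hp, hq, rotQuarterLin_mk3, rotQuarterLin_mk3, inner_mk3, inner_mk3]
  have h := two_mul_sHalf_sq
  linear_combination (p 0 * q 0 + p 1 * q 1) * h

/-- `R ∈ O(3)`: the rotation as a linear isometry. [cite: KreutzZiereis2026, Appendix A.1 p. 35] -/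
def rotQuarter : EuclideanSpace ℝ (Fin 3) ≃ₗᵢ[ℝ] EuclideanSpace ℝ (Fin 3) :=
  rotQuarterLin.isometryOfInner inner_rotQuarterLin

/-- `R` on coordinates. [cite: KreutzZiereis2026, Appendix A.1 p. 35] -/
theorem rotQuarter_mk3 (a b c : ℝ) :
    rotQuarter (mk3 a b c) = mk3 (sHalf * (a - b)) (sHalf * (a + b)) c := rfl

/-- `R ∈ SO(3)`: `det R = 2s² = 1`, PROVED. [cite: KreutzZiereis2026, Appendix A.1 p. 35] -/
theorem isRotation_rotQuarter : IsRotation rotQuarter := by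
  unfold IsRotation
  have hb : (rotQuarter.toLinearEquiv : EuclideanSpace ℝ (Fin 3) →ₗ[ℝ] EuclideanSpace ℝ (Fin 3)) =
      (rotQuarterLin : EuclideanSpace ℝ (Fin 3) →ₗ[ℝ] EuclideanSpace ℝ (Fin 3)) := by
    ext p i; rfl
  rw [hb, ← LinearMap.det_toMatrix (EuclideanSpace.basisFun (Fin 3) ℝ).toBasis, Matrix.det_fin_three]
  simp [LinearMap.toMatrix_apply, rotQuarterLin, mk3]
  have h := two_mul_sHalf_sq
  nlinarith [h]

/-- `ℤ³` is one of its own positioned copies (`R = id`, `τ = 0`). [cite: KreutzZiereis2026, (2.6) p. 5] -/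
theorem intLattice_mem_positionedCrystals : intLattice 3 ∈ positionedCrystals (intLattice 3) := by
  refine ⟨LinearIsometryEquiv.refl ℝ _, 0, ?_, ?_⟩
  · unfold IsRotation
    have hid : ((LinearIsometryEquiv.refl ℝ (EuclideanSpace ℝ (Fin 3))).toLinearEquiv :
        EuclideanSpace ℝ (Fin 3) →ₗ[ℝ] EuclideanSpace ℝ (Fin 3)) = LinearMap.id := by
      ext p i; rfl
    rw [hid, LinearMap.det_id]
  · ext p; simp

/-- `Rℤ³` is a positioned copy of `ℤ³`. [cite: KreutzZiereis2026, Appendix A.1 p. 35] -/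
theorem rot_intLattice_mem_positionedCrystals :
    rotQuarter '' intLattice 3 ∈ positionedCrystals (intLattice 3) :=
  ⟨rotQuarter, 0, isRotation_rotQuarter, by simp⟩

/-- Integer points of `ℝ³` lie in `ℤ³`. [cite: KreutzZiereis2026, (2.1) p. 4] -/
theorem mk3_int_mem_intLattice (a b c : ℤ) : mk3 a b c ∈ intLattice 3 :=
  ⟨![a, b, c], by rw [intPoint_three]; rfl⟩

/-- `{e₃} ∪ 𝒩(e₃) = {e₃, 0, 2e₃, e₃ ± e₁} ⊂ ℤ³`. [cite: KreutzZiereis2026, Appendix A.1 p. 35] -/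
theorem insert_nbhd_p1_subset : insert p1 (nbhd 1 1 sevenPoints p1) ⊆ intLattice 3 := by
  rw [nbhd_sevenPoints_p1]
  intro y hy
  simp only [Set.mem_insert_iff, Set.mem_singleton_iff] at hy
  rcases hy with rfl | rfl | rfl | rfl | rfl
  · simpa [p1] using mk3_int_mem_intLattice 0 0 1
  · simpa [p0] using mk3_int_mem_intLattice 0 0 0
  · simpa [p2] using mk3_int_mem_intLattice 0 0 2
  · simpa [p3] using mk3_int_mem_intLattice 1 0 1
  · simpa [p4] using mk3_int_mem_intLattice (-1) 0 1

/-- `{0} ∪ 𝒩(0) = {0, e₃, ±Re₁} ⊂ Rℤ³`. [cite: KreutzZiereis2026, Appendix A.1 p. 35] -/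
theorem insert_nbhd_p0_subset : insert p0 (nbhd 1 1 sevenPoints p0) ⊆ rotQuarter '' intLattice 3 := by
  rw [nbhd_sevenPoints_p0]
  intro y hy
  simp only [Set.mem_insert_iff, Set.mem_singleton_iff] at hy
  rcases hy with rfl | rfl | rfl | rfl
  · refine ⟨mk3 0 0 0, by simpa using mk3_int_mem_intLattice 0 0 0, ?_⟩
    rw [rotQuarter_mk3, p0, mk3_eq_iff]; norm_num
  · refine ⟨mk3 0 0 1, by simpa using mk3_int_mem_intLattice 0 0 1, ?_⟩
    rw [rotQuarter_mk3, p1, mk3_eq_iff]; norm_num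
  · refine ⟨mk3 1 0 0, by simpa using mk3_int_mem_intLattice 1 0 0, ?_⟩
    rw [rotQuarter_mk3, p5, mk3_eq_iff]; norm_num
  · refine ⟨mk3 (-1) 0 0, by simpa using mk3_int_mem_intLattice (-1) 0 0, ?_⟩
    rw [rotQuarter_mk3, p6, mk3_eq_iff]; norm_num

/-- `Re₁ ∉ ℤ³` (`(√2/2)² = ½` is not the square of an integer). [cite: KreutzZiereis2026, Appendix A.1 p. 35] -/
theorem p5_not_mem_intLattice : p5 ∉ intLattice 3 := by
  rintro ⟨k, hk⟩
  rw [intPoint_three, p5, mk3_eq_iff] at hk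
  have h1 : ((k 0 : ℤ) : ℝ) = sHalf := hk.1
  have hsq : ((k 0 : ℤ) : ℝ) ^ 2 = 1 / 2 := by rw [h1, sHalf_sq]
  rcases eq_or_ne (k 0) 0 with h0 | h0
  · rw [h0] at hsq; norm_num at hsq
  · have h2 : (1 : ℤ) ≤ |k 0| := Int.one_le_abs h0
    have h3 : (1 : ℝ) ≤ |((k 0 : ℤ) : ℝ)| := by exact_mod_cast h2
    have h4 : (1 : ℝ) ≤ ((k 0 : ℤ) : ℝ) ^ 2 := by
      rw [← sq_abs]; nlinarith [h3]
    linarith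

/-- `ℤ³ ≠ Rℤ³`. [cite: KreutzZiereis2026, Appendix A.1 p. 35] -/
theorem intLattice_ne_rot : intLattice 3 ≠ rotQuarter '' intLattice 3 := by
  intro h
  have h5 : p5 ∈ rotQuarter '' intLattice 3 :=
    insert_nbhd_p0_subset (by rw [nbhd_sevenPoints_p0]; simp)
  rw [← h] at h5
  exact p5_not_mem_intLattice h5

/-- **Appendix A.1, last paragraph, PROVED: axiom (E10) FAILS for the sticky-plus-angular cell energy
(A.2) on `ℤ³`** (with `r_int = 1`, `d_unique = 2d − 3 = 3`, any `C_{V₃}`).  Witness: the configuration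
`X = {0, e₃, 2e₃, e₃ + e₁, e₃ − e₁, Re₁, −Re₁}` (`R` the `π/4`-rotation in the `xy`-plane) and the pair
`(x, y) = (e₃, 0)`: `0 ∈ 𝒩(e₃)`, `#𝒩(e₃) = 4 ≥ 3`, `#𝒩(0) = 3 ≥ 3`, `{e₃} ∪ 𝒩(e₃) ⊂ ℤ³`,
`{0} ∪ 𝒩(0) ⊂ Rℤ³ ≠ ℤ³`, but `E₁(X ∖ {e₃}) = 16 > 15 = E₁(X)` (the source: "for `d = 3`, i.e. `ℤ³`, (E10) does
not hold … removing either `e₃` or `0` increases the energy" — removing `0` in fact leaves `E₁ = 15`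
unchanged; the pair `(e₃, 0)` is the one that violates (E10)). [cite: KreutzZiereis2026, Appendix A.1 p. 35] -/
theorem not_E10_intLattice_three (C : ℝ) : ¬ E10 (intLattice 3) 1 3 (stickyAngularCell 3 C) := by
  intro h
  have hy : p0 ∈ nbhd 1 1 sevenPoints p1 := by rw [nbhd_sevenPoints_p1]; simp
  have hmin : 3 ≤ min (nbhd 1 1 sevenPoints p1).ncard (nbhd 1 1 sevenPoints p0).ncard := by
    rw [ncard_nbhd_sevenPoints_p1, ncard_nbhd_sevenPoints_p0]; norm_num
  have key := h sevenPoints p1 p0 sevenPoints_finite (by simp [sevenPoints]) hy hmin (intLattice 3)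
    intLattice_mem_positionedCrystals (rotQuarter '' intLattice 3) rot_intLattice_mem_positionedCrystals
    insert_nbhd_p1_subset insert_nbhd_p0_subset intLattice_ne_rot
  rw [sevenPoints_diff, energy_sixPoints, energy_sevenPoints, ENNReal.ofReal_le_ofReal_iff (by norm_num)]
    at key
  norm_num at key

end Assembly

end Literature.MathematicalPhysics.StatisticalMechanics.KreutzZiereis2026
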